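import Summits.PneNP.PneNP.Theses.ConvexRankGates
import Literature.Computability.Complexity.ExtMonotoneCliqueGate
import Literature.Computability.Complexity.CircuitLowerBoundsProofs
import Literature.Computability.Complexity.CircuitSemantics
import Literature.Combinatorics.SimpleGraph.LovaszTheta

set_option linter.dupNamespace false

/-!
# Disproof work file — crux `ConvexGateBlind` (item stmt-PneNP-10680, route PneNP/ConvexRankGates)

Standing adversary's Lean record (cdisprove; generation 2 wrote §0–§E, generation 3 / cycle 2 adds
§A6, §B.2 and §E.6). Prose lives only in docstrings. Everything here is sorry-free.

## Findings index

* §0 `convexGateBlind_iff` — read-back: the crux is `∃ δ ∈ (0,1/2), CliqueHard δ`, where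
  `CliqueHard δ = ∀ c, ∀ᶠ m, Hard δ c m` and `Hard δ c m` says that no circuit over
  `basis (m^c) = {∧₂, ∨₂} ∪ CONV_{m^c}` with `≤ m^c` gates computes `CLIQUE(m, ⌈m^δ⌉₊)`
  (`cliqueFn`, definitionally the route's inline clique function).
* §A LOAD-BEARING ANALYSIS (each hypothesis dropped ⇒ provably false):
  `not_cliqueHardNoWidth` (drop the gate width `p + q ≤ m^c`: ONE minterm LP gate),
  `not_cliqueHardNoSize` (drop the size bound: the monotone DNF),
  `not_hard_of_rpow_le_two` / `not_cliqueHardAllM` (drop `∀ᶠ`: for `m^δ ≤ 2` the target is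
  `CLIQUE(m,2) = ∨` = one CONV₁ gate, so the threshold `m₀(δ, c)` must exceed `2^{1/δ}`),
  `not_cliqueHardConst` (natural strengthening "constant clique size k": false at `c = k + 3`),
  `cliqueHardSigned_imp_deMorgan` (drop `B ≥ 0`: `¬` becomes a CONV₁ gate and the statement turns
  into a general De Morgan circuit lower bound for CLIQUE),
  §A6 (gen 3) `not_hard_of_ceil_add_three_le` (`Hard δ c m` fails while `⌈m^δ⌉₊ + 3 ≤ c`: the
  threshold satisfies `m₀(δ,c) > (c-3)^{1/δ}`) and `not_cliqueHardUniform` (the quantifier swap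
  `∃ m₀ ∀ c` is false: the threshold must depend on `c`).
* §B RAZBOROV'S PAIR IS NOT ENOUGH (refuted strengthening + proof of support item 10684):
  `thetaGate m k` (one SDP gate, width `≤ 4m²+4`: `tr Y = 1`, `⟨J,Y⟩ ≥ k`, `|Y_ab| ≤ [x_ab]`),
  `thetaAcc_cliqueVec` / `not_thetaAcc_colorVec` (accepts all `k`-clique vectors, rejects all
  `(k-1)`-colouring vectors, via the in-tree Lovász sandwich), `thetaGateKillsRazborovPair`
  (= the route's support item, sorry-free), `not_blindOnRazborovPair` (the strengthening
  "poly CONV circuits cannot separate cliques from colourings" is false at `c = 3`, while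
  `cliqueHard_of_blindOnRazborovPair` shows it would have implied the crux). Infrastructure:
  `oneGate` (one-gate circuits), `isConvGate_of_fintype` (CONV data over arbitrary finite index
  types). §B.2 (gen 3, placed after §D) THE THETA GATE IS NEVER EXACT: `blowC5 m t` (blown-up
  5-cycle, blobs of size `t`, other vertices isolated) is `(2t+1)`-clique-free (`cliqueFn_blowC5`:
  a clique meets ≤ 2 blobs) yet theta-accepted up to threshold `11t/5` (`thetaAcc_blowC5`, witness
  `Yblow = (25t)⁻¹ N_{b(u)b(v)}`, `N = 5I + 3A(C₅) = LᵀDL` explicit); so `thetaGate m k` does not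
  compute `CLIQUE(m,k)` for `k ≥ 21`, `m ≥ 3k` (`not_thetaGate_computes`), and never
  `CLIQUE(m, ⌈m^δ⌉₊)` eventually, `0 < δ < 1` (`eventually_not_thetaGate_computes_cliqueFn`) — a
  deterministic ϑ-fooling negative family at every scale `k ≤ m/3` (the probabilistic
  `ϑ(G(m,½)) ≈ √m` covers only `k ≲ √m`). OPEN (recorded, not refuted): the LP-ONLY version of that strengthening — a Farkas
  certificate rejecting the colouring `h` is a weighting `w ≥ 0` with
  `w(h-bichromatic pairs) < min_Q w(E(Q))`, e.g. the pigeonhole certificate `w_h = Σ_c 𝟙_{E(P_c)}`,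
  which rejects only colourings close to `h`; whether poly-width LP gates separate Razborov's pair
  (an ε-sensitive nonnegative-rank question for the pigeonhole matrix
  `S[h,Q] = #(h-monochromatic pairs in Q) - 1`) is open either way, so the LP half of the crux MAY
  still go through colourings; only the SDP half provably needs other negatives.
* §C COLLAPSE (structure theorem, sorry-free): `exists_gate_of_isOver` — every circuit over
  `{∧₂, ∨₂} ∪ CONV_s` with `t` gates on `n` inputs is ONE CONV gate of width
  `collapseWidth t (max s 1) n = t·max(s,1) + t + 3t(n+t) + 1` (homogenisation: one block per gate,
  scalars `z_j`, `w_{j,u}`; soundness `getD_transcript_of_bigAcc` by strong induction along the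
  program, completeness `bigAcc_of_getD_transcript` from the transcript); hence
  `cliqueHard_iff_singleGateHard` and `convexGateBlind_iff_singleGate` — THE CRUX IS EXACTLY ITS
  SINGLE-GATE CASE (also landed independently by provers: `convexGateBlind_iff_oneGate`,
  Theorems/ConvexRankGatesConvexGateBlindOneGate.lean). §C.5 `gateHard_iff_dataHard`,
  `convexGateBlind_iff_data`: wiring absorbed — the crux is about CONV DATA
  `(p + q ≤ m^c; A, b, B ≥ 0)` on the edge variables (monotone projected spectrahedra).
* §E THE EXPONENT `δ` IS IMMATERIAL.
  §E.1–E.4 (apex padding, gen 2): `cliqueFn_extV` (`CLIQUE(m', k')` is a restriction of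
  `CLIQUE(m, k' + (m - m'))`), `ConvData.pad`, `exists_sub_ceil_eq` (discrete IVT for
  `j - ⌈j^δ⌉₊`), `cliqueHard_mono` (`0 < δ' ≤ δ < 1 ⇒ CliqueHard δ' → CliqueHard δ`).
  §E.5 `not_cliqueHard_one`: the boundary `δ = 1` is false (`CLIQUE(m,m) = ∧`).
  §E.6 (vertex deletion, gen 3): `cliqueFn_extZ` (`CLIQUE(m', k)` is a restriction of
  `CLIQUE(m, k)` for `k ≥ 2`), `ConvData.del`, `exists_ceil_rpow_eq` (discrete IVT for `⌈j^δ⌉₊`),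
  `le_pow_delExp` (`⌈m^δ⌉₊ = ⌈M^δ'⌉₊ ⇒ M ≤ m^⌈(1+δ)/δ'⌉₊`), `cliqueHard_anti`
  (`0 < δ' ≤ δ ≤ 1 ⇒ CliqueHard δ → CliqueHard δ'`). Together: `cliqueHard_iff_cliqueHard`
  (ALL `δ ∈ (0,1)` are equivalent) and `convexGateBlind_iff_cliqueHard` — FOR EACH SINGLE
  `δ ∈ (0,1)`, `ConvexGateBlind ↔ CliqueHard δ`. The crux is "poly CONV circuits do not compute
  `CLIQUE(m, ⌈√m⌉₊)`", equally "… `CLIQUE(m, ⌈m^{1/100}⌉₊)`"; the route's window `δ < 1/2` is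
  cosmetic; provers may fix the most convenient exponent (e.g. the Alon–Boppana regime of tiny
  `δ`, or `δ` near `1`), and `not_convexGateBlind_of_frequently`: cheap data at ANY one
  `δ ∈ (0,1)`, one `c`, infinitely many `m`, kill the crux.
* §D CERTIFICATES: `ConvData.not_acc_of_certificate` (dual certificates `y ≥ 0`, `Σ yᵢAᵢ ⪰ 0`,
  `y·(b + Bu) < 0` are SOUND; uses `trace_mul_nonneg_of_posSemidef` via the Schur product
  theorem), and the weak-infeasibility `gadget` (`Y₀₀ ≤ [u₀]`, `Y₀₁ ≥ 1`; `gadget_acc_true`,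
  `gadget_not_acc_false`, `gadget_no_certificate`): in the exact-feasibility format rejection need
  NOT carry a certificate, so "rejecting gate = non-negative separating certificate" requires a
  compactifying normal form (a redundant trace row; landed by provers as
  `certificate_of_infeasible_traceBounded`, Theorems/…Certificates.lean) before the route's
  Markov-per-certificate count can start.

## Why it resists (for ideators / planners)

* By §C the crux is a lower bound for ONE monotone SDP-feasibility description of polynomial
  width; its LP (diagonal) sub-case is the open problem of Oliveira–Pudlák (ToCT 2019, p. 3, §7.2)
  = Hrubeš's monotone separation complexity (ECCC TR19-034, Thm 20, Open Problem 3); the SDP case is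
  further out. No technique in print bounds these for an explicit function beyond `msep₁`
  (provers landed the unconditional corners: `q = 0`, width `≤ m`, few LP variables, few PSD
  dimensions — Theorems/ConvexRankGatesConvexGateBlind{Thresholds,Rows,LinearVariables,SdpFewDims}).
* Counting (Warren / quantifier elimination) bounds the number of width-`s` CONV functions on `n`
  inputs by `2^{poly(s,n)}`, so a RANDOM monotone function is hard — the statement is not
  universally false, and nothing finite or decidable is exposed: a counterexample would be a
  polynomial family of exact SDP descriptions of an NP-complete clique family, necessarily with
  numerically degenerate (non-robust) data, since robust rational data of polynomial bit-size would
  give P/poly circuits (ellipsoid) for `CLIQUE(m, m^δ)` infinitely often.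
* By §E the family `{CLIQUE(m, ⌈m^δ⌉₊)}_{δ ∈ (0,1)}` is ONE problem for this model: there is no
  "easy exponent" to attack and no "hard exponent" to prefer. The benchmark a counterexample must
  beat is the minterm gate of width `m^{k+3}`, `k = ⌈m^δ⌉₊` (§A3, §A6) — SUPERPOLYNOMIALLY, at some
  polynomial clique size. (Beating it at slowly growing `k`, e.g. an "FPT-width" gate
  `f(k)·m^{O(1)}`, would NOT refute the crux — hardness for slower-growing clique sizes is a
  formally STRONGER statement by the apex-padding argument of §E.4 — but it would kill every proof
  method that yields `m^{g(k)}` bounds with `g` unbounded, as Alon–Boppana-type approximation does.)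
* What a proof must do (this file): use the width bound (§A1) and the size bound (§A2) jointly, be
  false for constant `k` (§A3) and respect the `c`-dependent threshold (§A6), use `B ≥ 0` (§A5),
  defeat the theta gate — i.e. NOT be a clique/colouring argument on the SDP side (§B), be
  insensitive to `δ` (§E), and either avoid dual certificates or normalise gates first (§D).
-/

namespace Summit.PneNP.PneNP.Cruxes.ConvexGateBlind.Disproof

open Literature.Computability.Complexity Filter Finset Matrix
open Summit.PneNP.PneNP.Theses.ConvexRankGates (ConvexGateBlind)

noncomputable section

/-! ## §0 Read-back of the crux -/

/-- The input type of `CLIQUE(m, ·)`: edges of `K_m`. -/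
abbrev E (m : ℕ) : Type := (⊤ : SimpleGraph (Fin m)).edgeSet

/-- `CONV_s` as a set of gate functions (the route's inline `Conv s`, = `IsConvGate s`). -/
def Conv (s : ℕ) : Set GateFn := {g | IsConvGate s g}

/-- The crux's basis `{∧₂, ∨₂} ∪ CONV_s`. -/
def basis (s : ℕ) : Set GateFn := {GateFn.and 2, GateFn.or 2} ∪ Conv s

/-- `Hard δ c m`: no circuit over `basis (m^c)` with at most `m^c` gates computes
`CLIQUE(m, ⌈m^δ⌉₊)`. -/
def Hard (δ : ℝ) (c m : ℕ) : Prop :=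
  ∀ C : Circuit (E m), C.IsOver (basis (m ^ c)) → C.size ≤ m ^ c →
    ¬ C.Computes (cliqueFn m ⌈(m : ℝ) ^ δ⌉₊)

/-- `CliqueHard δ`: for every exponent `c`, eventually in `m`, `Hard δ c m`. -/
def CliqueHard (δ : ℝ) : Prop := ∀ c : ℕ, ∀ᶠ m : ℕ in atTop, Hard δ c m

/-- **Read-back.** The crux `ConvexGateBlind` is literally `∃ δ ∈ (0, 1/2), CliqueHard δ`
(definitional unfolding; the inline clique function is `cliqueFn m ⌈m^δ⌉₊`). -/
theorem convexGateBlind_iff : ConvexGateBlind ↔ ∃ δ : ℝ, 0 < δ ∧ δ < 1 / 2 ∧ CliqueHard δ :=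
  Iff.rfl

/-! ## §A Load-bearing analysis -/

/-! ### A1. The gate width `p + q ≤ m^c` is load-bearing -/

/-- The basis with CONV gates of UNBOUNDED width. -/
def basisNoWidth : Set GateFn := {GateFn.and 2, GateFn.or 2} ∪ {g | ∃ s, IsConvGate s g}

/-- The crux with the width bound on CONV gates dropped (size bound kept). -/
def CliqueHardNoWidth (δ : ℝ) : Prop :=
  ∀ c : ℕ, ∀ᶠ m : ℕ in atTop, ∀ C : Circuit (E m), C.IsOver basisNoWidth → C.size ≤ m ^ c →
    ¬ C.Computes (cliqueFn m ⌈(m : ℝ) ^ δ⌉₊)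

/-- **Any proof must use the width bound**: without it ONE gate (the minterm LP of CLIQUE,
`CliqueLPGate.exists_oneConvGate_computes`, width `C(m,k)·#E + 1 + C(m,k)`) computes
`CLIQUE(m, ⌈m^δ⌉₊)`, for every `δ` and already at `c = 0`. -/
theorem not_cliqueHardNoWidth (δ : ℝ) : ¬ CliqueHardNoWidth δ := by
  intro h
  obtain ⟨m, hm⟩ := (h 0).exists
  obtain ⟨C, hC, hsize, hcomp⟩ := CliqueLPGate.exists_oneConvGate_computes m ⌈(m : ℝ) ^ δ⌉₊
  refine hm C (hC.mono fun g hg => Or.inr ⟨_, hg⟩) ?_ hcomp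
  simpa using hsize

/-! ### A2. The size bound `C.size ≤ m^c` is load-bearing -/

/-- The crux with the size bound dropped (width bound kept). -/
def CliqueHardNoSize (δ : ℝ) : Prop :=
  ∀ c : ℕ, ∀ᶠ m : ℕ in atTop, ∀ C : Circuit (E m), C.IsOver (basis (m ^ c)) →
    ¬ C.Computes (cliqueFn m ⌈(m : ℝ) ^ δ⌉₊)

/-- For `δ > 0` and `m ≥ 2` the clique size `⌈m^δ⌉₊` is at least `2`. -/
theorem two_le_ceil_rpow {δ : ℝ} (hδ : 0 < δ) {m : ℕ} (hm : 2 ≤ m) : 2 ≤ ⌈(m : ℝ) ^ δ⌉₊ := by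
  have h1 : (1 : ℝ) < (m : ℝ) ^ δ := Real.one_lt_rpow (by exact_mod_cast hm) hδ
  have h2 : 1 < ⌈(m : ℝ) ^ δ⌉₊ := Nat.lt_ceil.2 (by exact_mod_cast h1)
  omega

/-- For `δ ≤ 1` and `m ≥ 1` the clique size `⌈m^δ⌉₊` is at most `m`. -/
theorem ceil_rpow_le {δ : ℝ} (hδ : δ ≤ 1) {m : ℕ} (hm : 1 ≤ m) : ⌈(m : ℝ) ^ δ⌉₊ ≤ m := by
  refine Nat.ceil_le.2 ?_
  calc (m : ℝ) ^ δ ≤ (m : ℝ) ^ (1 : ℝ) :=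
        Real.rpow_le_rpow_of_exponent_le (by exact_mod_cast hm) hδ
    _ = m := Real.rpow_one _

/-- **Any proof must use the size bound**: without it the monotone DNF of CLIQUE
(`exists_monotone_computes_cliqueFn_holds`, basis `{∧₂, ∨₂}` alone) computes the target. -/
theorem not_cliqueHardNoSize {δ : ℝ} (hδ : 0 < δ) (hδ1 : δ ≤ 1) : ¬ CliqueHardNoSize δ := by
  intro h
  obtain ⟨m, hm2, hm⟩ := ((eventually_ge_atTop 2).and (h 0)).exists
  obtain ⟨C, hC, hcomp⟩ := exists_monotone_computes_cliqueFn_holds (two_le_ceil_rpow hδ hm2)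
    (ceil_rpow_le hδ1 (by omega))
  exact hm C (hC.mono fun g hg => Or.inl hg) hcomp

/-! ### A3. Constant clique size is easy: `k = ⌈m^δ⌉₊ → ∞` is load-bearing -/

/-- The natural strengthening "the same lower bound for a FIXED clique size `k`". -/
def CliqueHardConst (k : ℕ) : Prop :=
  ∀ c : ℕ, ∀ᶠ m : ℕ in atTop, ∀ C : Circuit (E m), C.IsOver (basis (m ^ c)) → C.size ≤ m ^ c →
    ¬ C.Computes (cliqueFn m k)

/-- **False for every constant `k`** (at `c = k + 3`): the minterm LP gate has width
`≤ m^{k+3}` for `m ≥ 3` (`CliqueLPGate.lpWidth_le`). So any proof of the crux must fail for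
constant `k`; the benchmark to beat is the minterm gate of width `m^{Θ(k)}`. -/
theorem not_cliqueHardConst (k : ℕ) : ¬ CliqueHardConst k := by
  intro h
  obtain ⟨m, hm3, hm⟩ := ((eventually_ge_atTop 3).and (h (k + 3))).exists
  obtain ⟨C, hC, hsize, hcomp⟩ := CliqueLPGate.exists_oneConvGate_computes m k
  refine hm C (hC.mono fun g hg => Or.inr (IsConvGate.mono hg (CliqueLPGate.lpWidth_le m k hm3)))
    (hsize.trans (Nat.one_le_pow _ _ (by omega))) hcomp

/-! ### A4. `∀ᶠ m` is load-bearing: `CLIQUE(m, 2)` is one CONV₁ gate -/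

/-- `CLIQUE(m, 2)` is the OR of the edge variables. -/
theorem cliqueFn_two_eq_true_iff (m : ℕ) (x : E m → Bool) :
    cliqueFn m 2 x = true ↔ ∃ e, x e = true := by
  rw [CliqueLPGate.cliqueFn_eq_true_iff_exists]
  constructor
  · rintro ⟨S, hS, hx⟩
    obtain ⟨a, b, hab, rfl⟩ := Finset.card_eq_two.1 hS
    refine ⟨⟨s(a, b), (SimpleGraph.mem_edgeSet ⊤).2 ((SimpleGraph.top_adj a b).2 hab)⟩, hx _ ?_⟩
    intro y hy
    rcases Sym2.mem_iff.1 hy with rfl | rfl <;> simp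
  · rintro ⟨⟨e, he⟩, hx⟩
    induction e using Sym2.ind with
    | h a b =>
      have hab : a ≠ b := (SimpleGraph.top_adj a b).1 ((SimpleGraph.mem_edgeSet ⊤).1 he)
      refine ⟨{a, b}, Finset.card_pair hab, fun e' he' => ?_⟩
      obtain ⟨e', he'E⟩ := e'
      induction e' using Sym2.ind with
      | h c d =>
        have hcd : c ≠ d := (SimpleGraph.top_adj c d).1 ((SimpleGraph.mem_edgeSet ⊤).1 he'E)
        have hc : c ∈ ({a, b} : Finset (Fin m)) := he' c (Sym2.mem_mk_left c d)
        have hd : d ∈ ({a, b} : Finset (Fin m)) := he' d (Sym2.mem_mk_right c d)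
        have heq : s(c, d) = s(a, b) := by
          simp only [Finset.mem_insert, Finset.mem_singleton] at hc hd
          rcases hc with rfl | rfl <;> rcases hd with rfl | rfl
          · exact absurd rfl hcd
          · rfl
          · exact Sym2.eq_swap
          · exact absurd rfl hcd
        have hee : (⟨s(c, d), he'E⟩ : E m) = ⟨s(a, b), he⟩ := Subtype.ext heq
        rw [hee]
        exact hx

/-- `CLIQUE(m, 2)` is computed by ONE gate `∨_{#E} ∈ CONV₁ ⊆ basis s` (`1 ≤ s`). -/
theorem exists_orGate_computes_cliqueFn_two (m : ℕ) {s : ℕ} (hs : 1 ≤ s) :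
    ∃ C : Circuit (E m), C.IsOver (basis s) ∧ C.size ≤ 1 ∧ C.Computes (cliqueFn m 2) := by
  obtain ⟨C, hC, hsz, he⟩ := (CktSize.gate (B := basis s) (GateFn.or (CliqueLPGate.nE m))
    (Or.inr ((or_isConvGate _).mono hs)) (fun a => (CliqueLPGate.eE m).symm a)).toCircuit
  refine ⟨C, hC, hsz, fun x => ?_⟩
  rw [he x, Bool.eq_iff_iff, cliqueFn_two_eq_true_iff]
  simp only [GateFn.or, decide_eq_true_eq]
  constructor
  · rintro ⟨a, ha⟩
    exact ⟨_, ha⟩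
  · rintro ⟨e, he'⟩
    exact ⟨CliqueLPGate.eE m e, by simpa using he'⟩

/-- **Before `m^δ` exceeds `2` the statement is false at every `c`**: for `2 ≤ m` and
`m^δ ≤ 2` the target is `CLIQUE(m, 2) = ∨`, one CONV₁ gate. So the threshold `m₀(δ, c)` hidden
in `∀ᶠ m` must exceed `2^{1/δ}`: any proof must use largeness of `m` in terms of `δ`. -/
theorem not_hard_of_rpow_le_two {δ : ℝ} (hδ : 0 < δ) {c m : ℕ} (hm : 2 ≤ m)
    (h2 : (m : ℝ) ^ δ ≤ 2) : ¬ Hard δ c m := by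
  have hk : ⌈(m : ℝ) ^ δ⌉₊ = 2 :=
    le_antisymm (Nat.ceil_le.2 (by exact_mod_cast h2)) (two_le_ceil_rpow hδ hm)
  intro h
  obtain ⟨C, hC, hsz, hcomp⟩ :=
    exists_orGate_computes_cliqueFn_two m (Nat.one_le_pow c m (by omega))
  unfold Hard at h
  rw [hk] at h
  exact h C hC (hsz.trans (Nat.one_le_pow _ _ (by omega))) hcomp

/-- The crux with `∀ᶠ m` replaced by `∀ m ≥ 2`. -/
def CliqueHardAllM (δ : ℝ) : Prop := ∀ c m : ℕ, 2 ≤ m → Hard δ c m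

/-- **`∀ᶠ m` is load-bearing**: the all-`m` version fails at `m = 2` (`2^δ ≤ 2`). -/
theorem not_cliqueHardAllM {δ : ℝ} (hδ : 0 < δ) (hδ1 : δ ≤ 1) : ¬ CliqueHardAllM δ := fun h =>
  not_hard_of_rpow_le_two hδ (c := 0) le_rfl
    (by
      calc ((2 : ℕ) : ℝ) ^ δ ≤ ((2 : ℕ) : ℝ) ^ (1 : ℝ) :=
            Real.rpow_le_rpow_of_exponent_le (by norm_num) hδ1
        _ = 2 := by norm_num)
    (h 0 2 le_rfl)

/-! ### A5. `B ≥ 0` is load-bearing: without it `¬` is a gate -/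

/-- CONV gates WITHOUT the sign condition `B ≥ 0` on the input coefficients. -/
def IsConvGateSigned (s : ℕ) (g : GateFn) : Prop :=
  ∃ p q : ℕ, p + q ≤ s ∧ ∃ (A : Fin p → Matrix (Fin q) (Fin q) ℝ) (b : Fin p → ℝ)
    (B : Fin p → Fin g.1 → ℝ), ∀ v : Fin g.1 → Bool, g.2 v = true ↔
      ∃ Y : Matrix (Fin q) (Fin q) ℝ, Y.PosSemidef ∧
        ∀ i, (A i * Y).trace ≤ b i + ∑ j, B i j * (if v j then (1 : ℝ) else 0)

/-- Forgetting the sign condition. -/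
theorem isConvGateSigned_of_isConvGate {s : ℕ} {g : GateFn} (h : IsConvGate s g) :
    IsConvGateSigned s g := by
  obtain ⟨p, q, hpq, A, b, B, -, hg⟩ := h
  exact ⟨p, q, hpq, A, b, B, hg⟩

/-- Signed CONV gates grow with the width. -/
theorem IsConvGateSigned.mono {s t : ℕ} {g : GateFn} (h : IsConvGateSigned s g) (hst : s ≤ t) :
    IsConvGateSigned t g := by
  obtain ⟨p, q, hpq, rest⟩ := h
  exact ⟨p, q, hpq.trans hst, rest⟩

/-- **The negation gate is a signed CONV gate of width 1**: `¬v₀ ↔ 0 ≤ 0 - [v₀]`. -/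
theorem not_isConvGateSigned : IsConvGateSigned 1 GateFn.not := by
  refine ⟨1, 0, le_rfl, fun _ => 0, fun _ => 0, fun _ _ => -1, ?_⟩
  intro (v : Fin 1 → Bool)
  show (!(v 0)) = true ↔ ∃ Y : Matrix (Fin 0) (Fin 0) ℝ, Y.PosSemidef ∧
    ∀ i : Fin 1, ((0 : Matrix (Fin 0) (Fin 0) ℝ) * Y).trace ≤
      0 + ∑ j : Fin 1, (-1 : ℝ) * (if v j then (1 : ℝ) else 0)
  constructor
  · intro hv
    have h0 : v 0 = false := by simpa using hv
    refine ⟨0, Matrix.PosSemidef.zero, fun i => ?_⟩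
    simp [h0]
  · rintro ⟨Y, -, hY⟩
    have h0 := hY 0
    cases hv : v 0
    · rfl
    · simp [hv] at h0
      linarith

/-- The signed basis `{∧₂, ∨₂} ∪ CONV±_s`. -/
def basisSigned (s : ℕ) : Set GateFn := {GateFn.and 2, GateFn.or 2} ∪ {g | IsConvGateSigned s g}

/-- The De Morgan basis sits inside the signed basis (`1 ≤ s`). -/
theorem deMorganBasis_subset_basisSigned {s : ℕ} (hs : 1 ≤ s) : deMorganBasis ⊆ basisSigned s := by
  intro g hg
  simp only [deMorganBasis, Set.mem_insert_iff, Set.mem_singleton_iff] at hg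
  rcases hg with rfl | rfl | rfl
  · exact Or.inl (Or.inl rfl)
  · exact Or.inl (Or.inr rfl)
  · exact Or.inr (not_isConvGateSigned.mono hs)

/-- The crux with `B ≥ 0` dropped. -/
def CliqueHardSigned (δ : ℝ) : Prop :=
  ∀ c : ℕ, ∀ᶠ m : ℕ in atTop, ∀ C : Circuit (E m), C.IsOver (basisSigned (m ^ c)) →
    C.size ≤ m ^ c → ¬ C.Computes (cliqueFn m ⌈(m : ℝ) ^ δ⌉₊)

/-- A superpolynomial lower bound for `CLIQUE(m, ⌈m^δ⌉₊)` against GENERAL De Morgan circuits. -/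
def CliqueHardDeMorgan (δ : ℝ) : Prop :=
  ∀ c : ℕ, ∀ᶠ m : ℕ in atTop, ∀ C : Circuit (E m), C.IsOver deMorganBasis →
    C.size ≤ m ^ c → ¬ C.Computes (cliqueFn m ⌈(m : ℝ) ^ δ⌉₊)

/-- **Dropping `B ≥ 0` turns the crux into a general circuit lower bound**: the signed version
implies a superpolynomial De Morgan lower bound for `CLIQUE(m, ⌈m^δ⌉₊)` (an NP-complete family
for `δ ∈ (0, 1/2)`), i.e. it is at least as hard as the summit. Monotonicity by syntax is the
whole point of the model. -/
theorem cliqueHardSigned_imp_deMorgan (δ : ℝ) (h : CliqueHardSigned δ) : CliqueHardDeMorgan δ := by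
  intro c
  filter_upwards [h c, eventually_ge_atTop 1] with m hm h1 C hC hsz
  exact hm C (hC.mono (deMorganBasis_subset_basisSigned (Nat.one_le_pow _ _ h1))) hsz

/-! ### A6. The threshold hidden in `∀ᶠ m` must grow with `c` -/

/-- **`Hard δ c m` is false as long as `⌈m^δ⌉₊ + 3 ≤ c`** (`m ≥ 3`): the minterm LP gate has
width `≤ m^{⌈m^δ⌉₊ + 3} ≤ m^c` (`CliqueLPGate.lpWidth_le`). So the threshold `m₀(δ, c)` of the
crux satisfies `⌈m₀^δ⌉₊ > c - 3`, i.e. `m₀(δ, c) > (c - 3)^{1/δ}`: it tends to infinity with `c`,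
and a proof must, for each `c`, discard all `m` below that scale. -/
theorem not_hard_of_ceil_add_three_le {δ : ℝ} {c m : ℕ} (hm : 3 ≤ m)
    (hc : ⌈(m : ℝ) ^ δ⌉₊ + 3 ≤ c) : ¬ Hard δ c m := by
  intro h
  obtain ⟨C, hC, hsize, hcomp⟩ := CliqueLPGate.exists_oneConvGate_computes m ⌈(m : ℝ) ^ δ⌉₊
  have hw : CliqueLPGate.lpWidth m ⌈(m : ℝ) ^ δ⌉₊ ≤ m ^ c :=
    (CliqueLPGate.lpWidth_le m _ hm).trans (Nat.pow_le_pow_right (by omega) hc)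
  exact h C (hC.mono fun g hg => Or.inr (IsConvGate.mono hg hw))
    (hsize.trans (Nat.one_le_pow _ _ (by omega))) hcomp

/-- The crux with ONE threshold `m₀` serving every exponent `c` (quantifiers `∃ m₀ ∀ c` instead
of `∀ c ∃ m₀`). -/
def CliqueHardUniform (δ : ℝ) : Prop := ∃ m₀ : ℕ, ∀ c m : ℕ, m₀ ≤ m → Hard δ c m

/-- **The uniform-threshold version is false** (for every `δ`): at `m = max m₀ 3` take
`c = ⌈m^δ⌉₊ + 3`. The dependence of the threshold on `c` is essential. -/
theorem not_cliqueHardUniform (δ : ℝ) : ¬ CliqueHardUniform δ := by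
  rintro ⟨m₀, h⟩
  exact not_hard_of_ceil_add_three_le (le_max_right m₀ 3) le_rfl (h _ _ (le_max_left m₀ 3))

/-! ## §B Razborov's test pair is separated by ONE CONV gate (the Lovász theta gate)

The natural strengthening of the crux "polynomial CONV circuits cannot even separate the
`k`-clique vectors from the complete `(k-1)`-partite (colouring) vectors" is FALSE: one SDP gate of
width `≤ 4m² + 4` does it (Lovász sandwich). So Razborov's test distribution cannot prove the
crux, and the provers' colouring counts (Theorems/…Thresholds) cannot leave the `dim Y = 0` corner.
This also proves the route's support item `ThetaGateKillsRazborovPair` (stmt-PneNP-10684) outright.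
-/

section OneGate

variable {ι : Type*}

/-- The circuit consisting of ONE gate `g` wired to the inputs `w`. -/
def oneGate (g : GateFn) (w : Fin g.1 → ι) : Circuit ι where
  gates := [⟨g.1, g.2, fun a => .inl (w a)⟩]
  output := .inr 0
  wf j h a m hm := by
    simp only [List.length_singleton, Nat.lt_one_iff] at h
    subst h
    simp at hm
  wf_output m h := by cases h; simp

@[simp] theorem size_oneGate (g : GateFn) (w : Fin g.1 → ι) : (oneGate g w).size = 1 := rfl

@[simp] theorem eval_oneGate (g : GateFn) (w : Fin g.1 → ι) (x : ι → Bool) :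
    (oneGate g w).eval x = g.2 (fun a => x (w a)) := rfl

theorem isOver_oneGate {B : Set GateFn} {g : GateFn} (hg : g ∈ B) (w : Fin g.1 → ι) :
    (oneGate g w).IsOver B := by
  intro g' hg'
  simp only [oneGate, List.mem_singleton] at hg'
  subst hg'
  exact hg

end OneGate

section Transport

/-- Trace is invariant under simultaneous reindexing of rows and columns. -/
theorem trace_submatrix_equiv {n' m' : Type*} [Fintype n'] [Fintype m'] (M : Matrix n' n' ℝ)
    (e : m' ≃ n') : (M.submatrix e e).trace = M.trace := by
  simp only [Matrix.trace, Matrix.diag, Matrix.submatrix_apply]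
  exact e.sum_comp (fun i => M i i)

/-- **Transport lemma.** A CONV gate may be presented with ARBITRARY finite index types for its
rows and for its matrix variable; only `#rows + dim ≤ s` matters. (Used for the theta gate and
for the collapse theorem.) -/
theorem isConvGate_of_fintype {R Q : Type} [Fintype R] [Fintype Q] {s : ℕ} {g : GateFn}
    (hcard : Fintype.card R + Fintype.card Q ≤ s)
    (A : R → Matrix Q Q ℝ) (b : R → ℝ) (B : R → Fin g.1 → ℝ) (hB : ∀ r j, 0 ≤ B r j)
    (hg : ∀ v, g.2 v = true ↔ ∃ Y : Matrix Q Q ℝ, Y.PosSemidef ∧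
      ∀ r, (A r * Y).trace ≤ b r + ∑ j, B r j * (if v j then (1 : ℝ) else 0)) :
    IsConvGate s g := by
  classical
  let eR := Fintype.equivFin R
  let eQ := Fintype.equivFin Q
  refine ⟨Fintype.card R, Fintype.card Q, hcard, fun i => (A (eR.symm i)).submatrix eQ.symm eQ.symm,
    fun i => b (eR.symm i), fun i => B (eR.symm i), fun i j => hB _ _, fun v => ?_⟩
  rw [hg v]
  constructor
  · rintro ⟨Y, hY, hrows⟩
    refine ⟨Y.submatrix eQ.symm eQ.symm, hY.submatrix eQ.symm, fun i => ?_⟩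
    rw [Matrix.submatrix_mul_equiv, trace_submatrix_equiv]
    exact hrows (eR.symm i)
  · rintro ⟨Y', hY', hrows⟩
    refine ⟨Y'.submatrix eQ eQ, hY'.submatrix eQ, fun r => ?_⟩
    have h := hrows (eR r)
    simp only [eR, Equiv.symm_apply_apply] at h
    have hY'eq : Y' = (Y'.submatrix eQ eQ).submatrix eQ.symm eQ.symm := by
      ext a b; simp
    rw [hY'eq, Matrix.submatrix_mul_equiv, trace_submatrix_equiv] at h
    exact h

end Transport

section Theta

open Literature.Combinatorics.SimpleGraph
open scoped Classical

variable (m k : ℕ)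

/-- Ordered pairs of distinct vertices (they index the edge rows of the theta SDP). -/
abbrev OP (m : ℕ) : Type := {p : Fin m × Fin m // p.1 ≠ p.2}

/-- Row index of the theta SDP: three scalar rows and two rows per ordered pair. -/
abbrev ThetaRow (m : ℕ) : Type := Fin 3 ⊕ (OP m × Bool)

/-- The edge of `K_m` through an ordered pair of distinct vertices. -/
def edgeOf {m : ℕ} (p : OP m) : E m :=
  ⟨s(p.1.1, p.1.2), (SimpleGraph.mem_edgeSet ⊤).2 ((SimpleGraph.top_adj _ _).2 p.2)⟩

/-- The all-ones matrix `J`. -/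
def Jm (m : ℕ) : Matrix (Fin m) (Fin m) ℝ := Matrix.of fun _ _ => 1

/-- Constraint matrices of the theta gate: `tr Y ≤ 1`, `-tr Y ≤ -1`, `-⟨J, Y⟩ ≤ -k`,
`Y_ab ≤ [x_ab]`, `-Y_ab ≤ [x_ab]`. -/
def thetaA {m : ℕ} : ThetaRow m → Matrix (Fin m) (Fin m) ℝ :=
  Sum.elim ![1, -1, -Jm m] fun pb =>
    if pb.2 then Matrix.single pb.1.1.2 pb.1.1.1 1 else Matrix.single pb.1.1.2 pb.1.1.1 (-1)

/-- Constant terms of the theta gate. -/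
def thetab (m k : ℕ) : ThetaRow m → ℝ :=
  Sum.elim ![1, -1, -(k : ℝ)] fun _ => 0

/-- Input coefficients of the theta gate (`B ∈ {0,1}`, so `B ≥ 0`). -/
def thetaB {m : ℕ} : ThetaRow m → Fin (CliqueLPGate.nE m) → ℝ :=
  Sum.elim (fun _ _ => 0) fun pb j => if j = CliqueLPGate.eE m (edgeOf pb.1) then 1 else 0

/-- Acceptance of the theta SDP at an input `v` (inputs enumerated by `eE`). -/
def ThetaAcc (m k : ℕ) (v : Fin (CliqueLPGate.nE m) → Bool) : Prop :=
  ∃ Y : Matrix (Fin m) (Fin m) ℝ, Y.PosSemidef ∧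
    ∀ r, (thetaA r * Y).trace ≤ thetab m k r + ∑ j, thetaB r j * (if v j then (1 : ℝ) else 0)

/-- **The theta gate** `[∃ Y ⪰ 0 : tr Y = 1, ⟨J,Y⟩ ≥ k, -[ab ∈ x] ≤ Y_ab ≤ [ab ∈ x] (a ≠ b)]`,
arity `#E(K_m)`. -/
def thetaGate (m k : ℕ) : GateFn :=
  ⟨CliqueLPGate.nE m, fun v => decide (ThetaAcc m k v)⟩

theorem thetaB_nonneg {m : ℕ} (r : ThetaRow m) (j : Fin (CliqueLPGate.nE m)) : 0 ≤ thetaB r j := by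
  rcases r with i | pb
  · simp [thetaB]
  · simp only [thetaB, Sum.elim_inr]
    split_ifs <;> norm_num

/-- `#rows + dim Y ≤ 4m² + 4`. -/
theorem theta_card_le (m : ℕ) : Fintype.card (ThetaRow m) + Fintype.card (Fin m) ≤ 4 * m ^ 2 + 4 := by
  have hOP : Fintype.card (OP m) ≤ m ^ 2 := by
    calc Fintype.card (OP m) ≤ Fintype.card (Fin m × Fin m) := Fintype.card_subtype_le _
      _ = m ^ 2 := by simp [sq]
  simp only [Fintype.card_sum, Fintype.card_fin, Fintype.card_prod, Fintype.card_bool]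
  nlinarith

/-- The theta gate is a CONV gate of width `≤ 4m² + 4`. -/
theorem thetaGate_isConvGate : IsConvGate (4 * m ^ 2 + 4) (thetaGate m k) :=
  isConvGate_of_fintype (theta_card_le m) thetaA (thetab m k) thetaB thetaB_nonneg
    (fun _ => decide_eq_true_iff)

/-- The right-hand side of an edge row reads the input bit of that edge. -/
theorem theta_rhs_edge {m : ℕ} (x : E m → Bool) (pb : OP m × Bool) :
    (thetab m k (Sum.inr pb) + ∑ j, thetaB (Sum.inr pb) j *
        (if x ((CliqueLPGate.eE m).symm j) then (1 : ℝ) else 0)) =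
      if x (edgeOf pb.1) then 1 else 0 := by
  simp only [thetab, thetaB, Sum.elim_inr, zero_add]
  rw [Finset.sum_eq_single (CliqueLPGate.eE m (edgeOf pb.1))]
  · simp
  · intro j _ hj
    rw [if_neg hj, zero_mul]
  · intro h
    exact absurd (Finset.mem_univ _) h

/-- Unfolding the rows of the theta SDP at an input `x`: feasibility of `Y` means `Y ⪰ 0`,
`tr Y = 1`, `k ≤ Σ Y`, and `|Y_ab| ≤ [x_ab]` for `a ≠ b`. -/
theorem thetaAcc_iff {m k : ℕ} (x : E m → Bool) :
    ThetaAcc m k (fun j => x ((CliqueLPGate.eE m).symm j)) ↔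
      ∃ Y : Matrix (Fin m) (Fin m) ℝ, Y.PosSemidef ∧ Y.trace = 1 ∧ (k : ℝ) ≤ entrySum Y ∧
        ∀ p : OP m, |Y p.1.1 p.1.2| ≤ if x (edgeOf p) then 1 else 0 := by
  have hJ : ∀ Y : Matrix (Fin m) (Fin m) ℝ, (-Jm m * Y).trace = -entrySum Y := by
    intro Y
    simp only [Matrix.trace, Matrix.diag, Matrix.mul_apply, Jm, Matrix.neg_apply,
      Matrix.of_apply, neg_mul, one_mul, Finset.sum_neg_distrib, entrySum]
    rw [Finset.sum_comm]
  constructor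
  · rintro ⟨Y, hY, hr⟩
    refine ⟨Y, hY, ?_, ?_, fun p => ?_⟩
    · have h0 := hr (Sum.inl 0)
      have h1 := hr (Sum.inl 1)
      simp [thetaA, thetab, thetaB] at h0 h1
      linarith
    · have h2 := hr (Sum.inl 2)
      simp only [thetaA, thetab, thetaB, Sum.elim_inl, Matrix.cons_val_two, Matrix.tail_cons,
        Matrix.head_cons, zero_mul, Finset.sum_const_zero, add_zero] at h2
      rw [hJ] at h2
      linarith
    · have hu := hr (Sum.inr (p, true))
      have hd := hr (Sum.inr (p, false))
      rw [theta_rhs_edge] at hu hd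
      simp only [thetaA, Sum.elim_inr, if_true, Bool.false_eq_true, if_false,
        Matrix.trace_single_mul, smul_eq_mul, one_mul, neg_mul] at hu hd
      exact abs_le.2 ⟨by linarith, hu⟩
  · rintro ⟨Y, hY, htr, hsum, habs⟩
    refine ⟨Y, hY, fun r => ?_⟩
    rcases r with i | ⟨p, b⟩
    · fin_cases i
      · simp [thetaA, thetab, thetaB, htr]
      · simp [thetaA, thetab, thetaB, htr]
      · simp only [thetaA, thetab, thetaB, Sum.elim_inl, Fin.reduceFinMk, Matrix.cons_val_two,
          Matrix.tail_cons, Matrix.head_cons, zero_mul, Finset.sum_const_zero, add_zero]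
        rw [hJ]
        linarith
    · rw [theta_rhs_edge]
      have hp := abs_le.1 (habs p)
      cases b
      · simp only [thetaA, Sum.elim_inr, Bool.false_eq_true, if_false, Matrix.trace_single_mul,
          smul_eq_mul, neg_mul, one_mul]
        linarith [hp.1]
      · simp only [thetaA, Sum.elim_inr, if_true, Matrix.trace_single_mul, smul_eq_mul, one_mul]
        exact hp.2

/-- **The theta gate accepts every `k`-clique vector** (`k ≥ 1`): `Y = k⁻¹ 𝟙_S 𝟙_Sᵀ`. -/
theorem thetaAcc_cliqueVec {m k : ℕ} (hk : 1 ≤ k) (S : Finset (Fin m)) (hS : S.card = k) :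
    ThetaAcc m k (fun j => cliqueVec S ((CliqueLPGate.eE m).symm j)) := by
  classical
  rw [thetaAcc_iff]
  have hcl : (cliqueGraph (cliqueVec S)).IsNClique k S := ⟨isClique_cliqueVec S, hS⟩
  obtain ⟨hfeas, hval⟩ := isThetaFeasible_cliqueMatrix hcl (by omega)
  refine ⟨_, hfeas.posSemidef, hfeas.trace_eq_one, hval.ge, fun p => ?_⟩
  have hk0 : (0 : ℝ) < k := by exact_mod_cast hk
  simp only [Matrix.smul_apply, Matrix.vecMulVec_apply, indVec, smul_eq_mul]
  by_cases h1 : p.1.1 ∈ S <;> by_cases h2 : p.1.2 ∈ S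
  · have hx : cliqueVec S (edgeOf p) = true := by
      simp only [cliqueVec, edgeOf, decide_eq_true_eq]
      intro v hv
      rcases Sym2.mem_iff.1 hv with rfl | rfl
      · exact h1
      · exact h2
    rw [hx, if_pos rfl, if_pos h1, if_pos h2, mul_one, mul_one, abs_of_nonneg (by positivity)]
    exact inv_le_one_of_one_le₀ (by exact_mod_cast hk)
  all_goals
    simp only [h1, h2, if_true, if_false, mul_zero, mul_one, abs_zero]
    split_ifs <;> norm_num

/-- **The theta gate rejects every `(k-1)`-colouring vector** (`k ≥ 1`): a feasible `Y` would be
theta-feasible for the complement of the colouring graph, whence `k ≤ Σ Y ≤ ϑ ≤ k - 1`. -/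
theorem not_thetaAcc_colorVec {m k : ℕ} (hk : 1 ≤ k) (h : Fin m → Fin (k - 1)) :
    ¬ ThetaAcc m k (fun j => colorVec h ((CliqueLPGate.eE m).symm j)) := by
  classical
  rw [thetaAcc_iff]
  rintro ⟨Y, hY, htr, hsum, habs⟩
  set G := cliqueGraph (colorVec h) with hG
  have hfeas : IsThetaFeasible Gᶜ Y := by
    refine ⟨hY, htr, fun u v huv => ?_⟩
    rw [SimpleGraph.compl_adj] at huv
    obtain ⟨hne, hnadj⟩ := huv
    have hcol : h u = h v := by
      by_contra hc
      exact hnadj ((cliqueGraph_colorVec_adj h u v).2 hc)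
    have hx : colorVec h (edgeOf ⟨(u, v), hne⟩) = false := by
      simp [colorVec, edgeOf, hcol]
    have := habs ⟨(u, v), hne⟩
    rw [hx] at this
    simp only [Bool.false_eq_true, if_false] at this
    exact abs_nonpos_iff.1 this
  let C : G.Coloring (Fin (k - 1)) :=
    SimpleGraph.Coloring.mk h fun {u v} huv => (cliqueGraph_colorVec_adj h u v).1 huv
  have h1 : entrySum Y ≤ lovaszTheta Gᶜ :=
    le_csSup (bddAbove_thetaValues _) ⟨Y, hfeas, rfl⟩
  have h2 : lovaszTheta Gᶜ ≤ ((k - 1 : ℕ) : ℝ) := lovaszTheta_compl_le_of_coloring C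
  have h3 : ((k - 1 : ℕ) : ℝ) = (k : ℝ) - 1 := by
    rw [Nat.cast_sub hk, Nat.cast_one]
  linarith

/-- **Proof of the route's support item `ThetaGateKillsRazborovPair` (stmt-PneNP-10684)**: for
`2 ≤ k ≤ m` the one-gate circuit `oneGate (thetaGate m k)` over `CONV_{4m²+4}` accepts every
`k`-clique vector and rejects every `(k-1)`-colouring vector. (Positive result: travels as
evidence for a prover; recorded here because it refutes the strengthening of the crux below.) -/
theorem thetaGateKillsRazborovPair :
    Summit.PneNP.PneNP.Theses.ConvexRankGates.ThetaGateKillsRazborovPair := by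
  intro m k hk _hkm
  refine ⟨oneGate (thetaGate m k) (fun a => (CliqueLPGate.eE m).symm a),
    isOver_oneGate (thetaGate_isConvGate m k) _, rfl, fun S hS => ?_, fun h => ?_⟩
  · rw [eval_oneGate]
    show decide (ThetaAcc m k fun j => cliqueVec S ((CliqueLPGate.eE m).symm j)) = true
    exact decide_eq_true (thetaAcc_cliqueVec (by omega) S hS)
  · rw [eval_oneGate]
    show decide (ThetaAcc m k fun j => colorVec h ((CliqueLPGate.eE m).symm j)) = false
    exact decide_eq_false (not_thetaAcc_colorVec (by omega) h)

/-- The natural strengthening of the crux: "polynomial CONV circuits cannot separate Razborov's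
pair (k-clique vectors vs `(k-1)`-colouring vectors), `k = ⌈m^δ⌉₊`". -/
def BlindOnRazborovPair (δ : ℝ) : Prop :=
  ∀ c : ℕ, ∀ᶠ m : ℕ in atTop, ∀ C : Circuit (E m), C.IsOver (basis (m ^ c)) → C.size ≤ m ^ c →
    ¬ ((∀ S : Finset (Fin m), S.card = ⌈(m : ℝ) ^ δ⌉₊ → C.eval (cliqueVec S) = true) ∧
       (∀ h : Fin m → Fin (⌈(m : ℝ) ^ δ⌉₊ - 1), C.eval (colorVec h) = false))

/-- The strengthening implies the crux (a circuit computing CLIQUE separates the pair). -/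
theorem cliqueHard_of_blindOnRazborovPair {δ : ℝ} (hδ : 0 < δ) (h : BlindOnRazborovPair δ) :
    CliqueHard δ := by
  intro c
  filter_upwards [h c, eventually_ge_atTop 2] with m hm hm2 C hC hsz hcomp
  refine hm C hC hsz ⟨fun S hS => ?_, fun g => ?_⟩
  · rw [hcomp]
    exact cliqueFn_cliqueVec hS.ge
  · rw [hcomp]
    have hk := two_le_ceil_rpow hδ hm2
    exact cliqueFn_colorVec g (by omega)

/-- **The strengthening is FALSE** (for every `δ > 0`, at `c = 3`, `m ≥ 5`): the theta gate.
Hence no proof of the crux can go through Razborov's clique/colouring test distribution — the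
dense random negatives of the route (or something else defeating theta) are necessary. -/
theorem not_blindOnRazborovPair {δ : ℝ} (hδ : 0 < δ) : ¬ BlindOnRazborovPair δ := by
  intro h
  obtain ⟨m, hm5, hm⟩ := ((eventually_ge_atTop 5).and (h 3)).exists
  set k := ⌈(m : ℝ) ^ δ⌉₊ with hk
  have hk2 : 2 ≤ k := two_le_ceil_rpow hδ (by omega)
  have hwidth : 4 * m ^ 2 + 4 ≤ m ^ 3 := by nlinarith
  refine hm (oneGate (thetaGate m k) (fun a => (CliqueLPGate.eE m).symm a))
    (isOver_oneGate (Or.inr ((thetaGate_isConvGate m k).mono hwidth)) _)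
    (by rw [size_oneGate]; exact Nat.one_le_pow _ _ (by omega)) ⟨fun S hS => ?_, fun g => ?_⟩
  · rw [eval_oneGate]
    show decide (ThetaAcc m k fun j => cliqueVec S ((CliqueLPGate.eE m).symm j)) = true
    exact decide_eq_true (thetaAcc_cliqueVec (by omega) S hS)
  · rw [eval_oneGate]
    show decide (ThetaAcc m k fun j => colorVec g ((CliqueLPGate.eE m).symm j)) = false
    exact decide_eq_false (not_thetaAcc_colorVec (by omega) g)

end Theta

/-! ## §C COLLAPSE: an `{∧₂, ∨₂} ∪ CONV_s` circuit is ONE CONV gate of polynomial width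

For a circuit `C` with `t` gates, all CONV gates of width `≤ s` (`∧₂, ∨₂ ∈ CONV₁`), on a finite
input type of size `n`, there is ONE CONV gate of width `≤ t·s + t + 3·t·(n+t) + 1` computing the
same function. Construction (exact-feasibility format, arbitrary real data): one block `Y_j` per
gate, one scalar `z_j ≥ 0` per gate ("gate `j` certified true iff `z_j > 0`") and one scalar
`w_{j,u}` per (gate, wire); rows: the HOMOGENISED rows `tr(A^j_i Y_j) ≤ b^j_i z_j + Σ_a B^j_{ia} w_{j,wire(a)}`,
`w_{j,u} ≤ z_j`, `w_{j,x_i} ≤ [x_i]`, `w_{j,gate m} ≤ z_m`, and `z_out ≥ 1`. Soundness: by strong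
induction `z_j > 0 ⇒ gate j true` (divide by `z_j`, `B ≥ 0`); completeness: `z_j = [gate j true]`,
`w_{j,u} = [gate j true ∧ wire u true]`, `Y_j =` a witness. Consequence (§C.4): the crux is
EQUIVALENT to its single-gate case — a psd-lift lower bound for one SDP-feasibility gate.
-/

section Collapse

/-! ### C.1 Data of CONV gates -/

/-- The data `(p, q, A, b, B)` of a CONV gate of arity `k` and width `≤ s`. -/
structure ConvData (k s : ℕ) where
  /-- number of rows -/
  p : ℕ
  /-- dimension of the matrix variable -/
  q : ℕ
  hpq : p + q ≤ s
  A : Fin p → Matrix (Fin q) (Fin q) ℝ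
  b : Fin p → ℝ
  B : Fin p → Fin k → ℝ
  hB : ∀ i j, 0 ≤ B i j

/-- Acceptance of the data at an input `u`. -/
def ConvData.Acc {k s : ℕ} (D : ConvData k s) (u : Fin k → Bool) : Prop :=
  ∃ Y : Matrix (Fin D.q) (Fin D.q) ℝ, Y.PosSemidef ∧
    ∀ i, (D.A i * Y).trace ≤ D.b i + ∑ j, D.B i j * (if u j then (1 : ℝ) else 0)

theorem exists_convData {s : ℕ} {g : GateFn} (h : IsConvGate s g) :
    ∃ D : ConvData g.1 s, ∀ u, g.2 u = true ↔ D.Acc u := by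
  obtain ⟨p, q, hpq, A, b, B, hB, hg⟩ := h
  exact ⟨⟨p, q, hpq, A, b, B, hB⟩, hg⟩

/-- Acceptance is monotone in the input (`B ≥ 0`). -/
theorem ConvData.acc_mono {k s : ℕ} (D : ConvData k s) {u u' : Fin k → Bool} (huu' : u ≤ u')
    (h : D.Acc u) : D.Acc u' := by
  obtain ⟨Y, hY, hc⟩ := h
  refine ⟨Y, hY, fun i => (hc i).trans ?_⟩
  exact add_le_add le_rfl (Finset.sum_le_sum fun j _ =>
    mul_le_mul_of_nonneg_left (indicator_le_indicator huu' j) (D.hB i j))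

/-! ### C.2 The big SDP of a CONV circuit -/

variable {ι : Type} [Fintype ι] [DecidableEq ι] {s : ℕ}
variable (C : Circuit ι) (D : ∀ j : Fin C.gates.length, ConvData (C.gates[j]).arity s)

/-- Wires: an input or a gate. -/
abbrev Wire (C : Circuit ι) : Type := ι ⊕ Fin C.gates.length

/-- Index of the big matrix variable: gate blocks, then the scalars `z_j`, then the scalars
`w_{j,u}`. -/
abbrev QIdx : Type :=
  (Σ j : Fin C.gates.length, Fin (D j).q) ⊕ (Fin C.gates.length ⊕ (Fin C.gates.length × Wire C))

/-- Index of the rows: homogenised gate rows, `w ≤ z` rows, `w ≤ value` rows, the output row. -/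
abbrev RIdx : Type :=
  (Σ j : Fin C.gates.length, Fin (D j).p) ⊕
    ((Fin C.gates.length × Wire C) ⊕ ((Fin C.gates.length × Wire C) ⊕ Unit))

variable {C D}

/-- The wire of the program read as a `Wire` (out-of-range back-references, impossible for actual
arguments by well-formedness, are sent to the reading gate itself). -/
def toW (j : Fin C.gates.length) : ι ⊕ ℕ → Wire C
  | .inl i => .inl i
  | .inr m => if h : m < C.gates.length then .inr ⟨m, h⟩ else .inr j

/-- Position of `z_j`. -/
abbrev zI (j : Fin C.gates.length) : QIdx C D := Sum.inr (Sum.inl j)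

/-- Position of `w_{j,u}`. -/
abbrev wI (j : Fin C.gates.length) (u : Wire C) : QIdx C D := Sum.inr (Sum.inr (j, u))

/-- Position of the block entry `(Y_j)_{u u'}` is `(bI j u, bI j u')`. -/
abbrev bI (j : Fin C.gates.length) (u : Fin (D j).q) : QIdx C D := Sum.inl ⟨j, u⟩

/-- The matrix reading the entry `(a, b)`: `tr (rd a b * Y) = Y a b`. -/
def rd (a b : QIdx C D) : Matrix (QIdx C D) (QIdx C D) ℝ := Matrix.single b a 1

theorem trace_rd_mul (a b : QIdx C D) (Y : Matrix (QIdx C D) (QIdx C D) ℝ) :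
    (rd a b * Y).trace = Y a b := by
  rw [rd, Matrix.trace_single_mul, smul_eq_mul, one_mul]

/-- The `j`-th diagonal block of a big matrix. -/
def blk (Y : Matrix (QIdx C D) (QIdx C D) ℝ) (j : Fin C.gates.length) :
    Matrix (Fin (D j).q) (Fin (D j).q) ℝ :=
  Y.submatrix (fun u => bI j u) (fun u => bI j u)

/-- The lift of gate `j`'s row matrix `A` to the big index: `tr (liftA j A * Y) = tr (A * blk Y j)`. -/
def liftA (j : Fin C.gates.length) (A : Matrix (Fin (D j).q) (Fin (D j).q) ℝ) :
    Matrix (QIdx C D) (QIdx C D) ℝ :=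
  ∑ u, ∑ u', A u u' • rd (bI j u') (bI j u)

theorem trace_liftA_mul (j : Fin C.gates.length) (A : Matrix (Fin (D j).q) (Fin (D j).q) ℝ)
    (Y : Matrix (QIdx C D) (QIdx C D) ℝ) :
    (liftA j A * Y).trace = (A * blk Y j).trace := by
  simp only [liftA, Matrix.sum_mul, Matrix.smul_mul, Matrix.trace_sum, Matrix.trace_smul,
    trace_rd_mul, smul_eq_mul]
  simp only [Matrix.trace, Matrix.diag, Matrix.mul_apply, blk, Matrix.submatrix_apply]

/-- The wire feeding argument `a` of gate `j`. -/
def argW (j : Fin C.gates.length) (a : Fin (C.gates[j]).arity) : Wire C :=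
  toW j ((C.gates[j]).args a)

/-- Row matrices of the big SDP (the output gate is `o`). -/
def rowA (o : Fin C.gates.length) : RIdx C D → Matrix (QIdx C D) (QIdx C D) ℝ
  | .inl ⟨j, i⟩ => liftA j ((D j).A i) + (-(D j).b i) • rd (zI j) (zI j) +
      ∑ a, (-(D j).B i a) • rd (wI j (argW j a)) (wI j (argW j a))
  | .inr (.inl (j, u)) => rd (wI j u) (wI j u) - rd (zI j) (zI j)
  | .inr (.inr (.inl (j, .inl i))) => rd (wI j (.inl i)) (wI j (.inl i))
  | .inr (.inr (.inl (j, .inr m))) => rd (wI j (.inr m)) (wI j (.inr m)) - rd (zI m) (zI m)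
  | .inr (.inr (.inr _)) => -rd (zI o) (zI o)

/-- Constant terms of the big SDP. -/
def rowb : RIdx C D → ℝ
  | .inr (.inr (.inr _)) => -1
  | _ => 0

/-- Input coefficients of the big SDP (inputs enumerated by `e`): only the rows
`w_{j,x_i} ≤ [x_i]` read the input. -/
def rowB (e : ι ≃ Fin (Fintype.card ι)) : RIdx C D → Fin (Fintype.card ι) → ℝ
  | .inr (.inr (.inl (_, .inl i))) => fun a => if a = e i then 1 else 0
  | _ => fun _ => 0

omit [DecidableEq ι] in
theorem rowB_nonneg (e : ι ≃ Fin (Fintype.card ι)) (r : RIdx C D) (a : Fin (Fintype.card ι)) :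
    0 ≤ rowB e r a := by
  rcases r with _ | _ | ⟨_, _ | _⟩ | _ <;> simp only [rowB] <;> try exact le_rfl
  split_ifs <;> norm_num

/-- Acceptance of the big SDP at the input `v` (output gate `o`). -/
def BigAcc (o : Fin C.gates.length) (e : ι ≃ Fin (Fintype.card ι)) (v : Fin (Fintype.card ι) → Bool) :
    Prop :=
  ∃ Y : Matrix (QIdx C D) (QIdx C D) ℝ, Y.PosSemidef ∧
    ∀ r, (rowA o r * Y).trace ≤ rowb r + ∑ a, rowB e r a * (if v a then (1 : ℝ) else 0)

open scoped Classical in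
/-- **The collapsed gate** of the CONV circuit `(C, D)` with output gate `o`. -/
def bigGate (o : Fin C.gates.length) (e : ι ≃ Fin (Fintype.card ι)) : GateFn :=
  ⟨Fintype.card ι, fun v => decide (BigAcc (D := D) o e v)⟩

/-- The width of the collapsed gate. -/
def collapseWidth (t s n : ℕ) : ℕ := t * s + t + 3 * (t * (n + t)) + 1

omit [DecidableEq ι] in
/-- `#rows + dim` of the big SDP is at most `collapseWidth t s n`. -/
theorem card_RIdx_add_card_QIdx_le :
    Fintype.card (RIdx C D) + Fintype.card (QIdx C D) ≤
      collapseWidth C.gates.length s (Fintype.card ι) := by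
  have hpq : (∑ j : Fin C.gates.length, (D j).p) + ∑ j : Fin C.gates.length, (D j).q ≤
      C.gates.length * s := by
    rw [← Finset.sum_add_distrib]
    calc ∑ j : Fin C.gates.length, ((D j).p + (D j).q) ≤ ∑ _j : Fin C.gates.length, s :=
          Finset.sum_le_sum fun j _ => (D j).hpq
      _ = C.gates.length * s := by simp
  simp only [Fintype.card_sum, Fintype.card_sigma, Fintype.card_fin, Fintype.card_prod,
    Fintype.card_unit, collapseWidth]
  omega

open scoped Classical in
/-- **The collapsed gate is a CONV gate of width `collapseWidth t s n`.** -/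
theorem bigGate_isConvGate (o : Fin C.gates.length) (e : ι ≃ Fin (Fintype.card ι)) :
    IsConvGate (collapseWidth C.gates.length s (Fintype.card ι)) (bigGate (D := D) o e) :=
  isConvGate_of_fintype card_RIdx_add_card_QIdx_le (rowA o) rowb (rowB e) (rowB_nonneg e)
    (fun _ => decide_eq_true_iff)

/-! ### C.3 Semantics of the big SDP -/

section Rows

variable (o : Fin C.gates.length) (e : ι ≃ Fin (Fintype.card ι)) (Y : Matrix (QIdx C D) (QIdx C D) ℝ)

theorem trace_rowA_gate (j : Fin C.gates.length) (i : Fin (D j).p) :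
    (rowA o (Sum.inl ⟨j, i⟩) * Y).trace =
      ((D j).A i * blk Y j).trace + (-(D j).b i) * Y (zI j) (zI j) +
        ∑ a, (-(D j).B i a) * Y (wI j (argW j a)) (wI j (argW j a)) := by
  simp only [rowA, Matrix.add_mul, Matrix.trace_add, Matrix.smul_mul, Matrix.trace_smul,
    Matrix.sum_mul, Matrix.trace_sum, trace_rd_mul, trace_liftA_mul, smul_eq_mul]

theorem trace_rowA_wz (j : Fin C.gates.length) (u : Wire C) :
    (rowA o (Sum.inr (Sum.inl (j, u))) * Y).trace = Y (wI j u) (wI j u) - Y (zI j) (zI j) := by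
  simp only [rowA, Matrix.sub_mul, Matrix.trace_sub, trace_rd_mul]

theorem trace_rowA_wx (j : Fin C.gates.length) (i : ι) :
    (rowA o (Sum.inr (Sum.inr (Sum.inl (j, Sum.inl i)))) * Y).trace =
      Y (wI j (Sum.inl i)) (wI j (Sum.inl i)) := by
  simp only [rowA, trace_rd_mul]

theorem trace_rowA_wg (j m : Fin C.gates.length) :
    (rowA o (Sum.inr (Sum.inr (Sum.inl (j, Sum.inr m)))) * Y).trace =
      Y (wI j (Sum.inr m)) (wI j (Sum.inr m)) - Y (zI m) (zI m) := by
  simp only [rowA, Matrix.sub_mul, Matrix.trace_sub, trace_rd_mul]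

theorem trace_rowA_out :
    (rowA o (Sum.inr (Sum.inr (Sum.inr ()))) * Y).trace = -Y (zI o) (zI o) := by
  simp only [rowA, Matrix.neg_mul, Matrix.trace_neg, trace_rd_mul]

omit [DecidableEq ι] in
/-- The right-hand side of an input row reads the input bit. -/
theorem rhs_wx (x : ι → Bool) (j : Fin C.gates.length) (i : ι) :
    (rowb (C := C) (D := D) (Sum.inr (Sum.inr (Sum.inl (j, Sum.inl i)))) +
        ∑ a, rowB (C := C) (D := D) e (Sum.inr (Sum.inr (Sum.inl (j, Sum.inl i)))) a *
          (if x (e.symm a) then (1 : ℝ) else 0)) = if x i then 1 else 0 := by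
  simp only [rowb, rowB, zero_add]
  rw [Finset.sum_eq_single (e i)]
  · simp
  · intro a _ ha
    rw [if_neg ha, zero_mul]
  · intro h
    exact absurd (Finset.mem_univ _) h

/-- **The rows of the big SDP, unfolded.** -/
theorem bigRows_iff (x : ι → Bool) :
    (∀ r, (rowA o r * Y).trace ≤
        rowb r + ∑ a, rowB e r a * (if x (e.symm a) then (1 : ℝ) else 0)) ↔
      (∀ (j : Fin C.gates.length) (i : Fin (D j).p), ((D j).A i * blk Y j).trace ≤
          (D j).b i * Y (zI j) (zI j) + ∑ a, (D j).B i a * Y (wI j (argW j a)) (wI j (argW j a))) ∧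
      (∀ (j : Fin C.gates.length) (u : Wire C), Y (wI j u) (wI j u) ≤ Y (zI j) (zI j)) ∧
      (∀ (j : Fin C.gates.length) (i : ι), Y (wI j (Sum.inl i)) (wI j (Sum.inl i)) ≤
          if x i then 1 else 0) ∧
      (∀ j m : Fin C.gates.length, Y (wI j (Sum.inr m)) (wI j (Sum.inr m)) ≤ Y (zI m) (zI m)) ∧
      1 ≤ Y (zI o) (zI o) := by
  constructor
  · intro h
    refine ⟨fun j i => ?_, fun j u => ?_, fun j i => ?_, fun j m => ?_, ?_⟩
    · have h1 := h (Sum.inl ⟨j, i⟩)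
      rw [trace_rowA_gate] at h1
      simp only [rowb, rowB, zero_mul, Finset.sum_const_zero, add_zero] at h1
      have : ∑ a, (-(D j).B i a) * Y (wI j (argW j a)) (wI j (argW j a)) =
          -∑ a, (D j).B i a * Y (wI j (argW j a)) (wI j (argW j a)) := by
        rw [← Finset.sum_neg_distrib]
        exact Finset.sum_congr rfl fun a _ => by ring
      rw [this] at h1
      linarith
    · have h1 := h (Sum.inr (Sum.inl (j, u)))
      rw [trace_rowA_wz] at h1
      simp only [rowb, rowB, zero_mul, Finset.sum_const_zero, add_zero] at h1
      linarith
    · have h1 := h (Sum.inr (Sum.inr (Sum.inl (j, Sum.inl i))))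
      rw [trace_rowA_wx, rhs_wx] at h1
      exact h1
    · have h1 := h (Sum.inr (Sum.inr (Sum.inl (j, Sum.inr m))))
      rw [trace_rowA_wg] at h1
      simp only [rowb, rowB, zero_mul, Finset.sum_const_zero, add_zero] at h1
      linarith
    · have h1 := h (Sum.inr (Sum.inr (Sum.inr ())))
      rw [trace_rowA_out] at h1
      simp only [rowb, rowB, zero_mul, Finset.sum_const_zero, add_zero] at h1
      linarith
  · rintro ⟨h1, h2, h3, h4, h5⟩ r
    rcases r with ⟨j, i⟩ | ⟨j, u⟩ | ⟨j, i | m⟩ | _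
    · rw [trace_rowA_gate]
      simp only [rowb, rowB, zero_mul, Finset.sum_const_zero, add_zero]
      have : ∑ a, (-(D j).B i a) * Y (wI j (argW j a)) (wI j (argW j a)) =
          -∑ a, (D j).B i a * Y (wI j (argW j a)) (wI j (argW j a)) := by
        rw [← Finset.sum_neg_distrib]
        exact Finset.sum_congr rfl fun a _ => by ring
      rw [this]
      linarith [h1 j i]
    · rw [trace_rowA_wz]
      simp only [rowb, rowB, zero_mul, Finset.sum_const_zero, add_zero]
      linarith [h2 j u]
    · rw [trace_rowA_wx, rhs_wx]
      exact h3 j i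
    · rw [trace_rowA_wg]
      simp only [rowb, rowB, zero_mul, Finset.sum_const_zero, add_zero]
      linarith [h4 j m]
    · rw [trace_rowA_out]
      simp only [rowb, rowB, zero_mul, Finset.sum_const_zero, add_zero]
      linarith

end Rows

/-- The true value of a wire at input `x` (transcript `T`). -/
def wireT (x : ι → Bool) (T : List Bool) : Wire C → Bool
  | .inl i => x i
  | .inr m => T.getD m false

omit [Fintype ι] [DecidableEq ι] in
/-- For an actual argument of gate `j`, `argW` followed by `wireT` is the program's `wireVal`
(well-formedness: back-references are in range). -/
theorem wireT_argW (x : ι → Bool) (T : List Bool) (j : Fin C.gates.length)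
    (a : Fin (C.gates[j]).arity) :
    wireT (C := C) x T (argW j a) = wireVal x T ((C.gates[j]).args a) := by
  unfold argW
  cases h : (C.gates[j]).args a with
  | inl i => rfl
  | inr m =>
    have hm : m < C.gates.length := (C.wf j j.2 a m h).trans j.2
    simp only [toW, dif_pos hm, wireT, wireVal]

omit [Fintype ι] [DecidableEq ι] in
/-- A gate argument wired to gate `m'` refers below the gate's own index (well-formedness). -/
theorem lt_of_argW_eq_inr {j : Fin C.gates.length} {a : Fin (C.gates[j]).arity}
    {m' : Fin C.gates.length} (h : argW j a = Sum.inr m') : (m' : ℕ) < (j : ℕ) := by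
  unfold argW at h
  cases ha : (C.gates[j]).args a with
  | inl i => rw [ha] at h; simp [toW] at h
  | inr m =>
    rw [ha] at h
    have hmj : m < (j : ℕ) := C.wf j j.2 a m ha
    have hm : m < C.gates.length := hmj.trans j.2
    simp only [toW, dif_pos hm, Sum.inr.injEq] at h
    rw [← h]
    exact hmj

omit [Fintype ι] [DecidableEq ι] in
/-- Gate `j`'s transcript value is its CONV data's verdict on the true argument values. -/
theorem getD_transcript_iff (hD : ∀ (j : Fin C.gates.length) u, (C.gates[j]).op u = true ↔ (D j).Acc u)
    (x : ι → Bool) (j : Fin C.gates.length) :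
    (transcript x [] C.gates).getD j false = true ↔
      (D j).Acc fun a => wireT (C := C) x (transcript x [] C.gates) (argW j a) := by
  rw [getD_transcript_eq_gateValue C x j j.2]
  show (C.gates[j]).op _ = true ↔ _
  rw [hD j]
  simp only [wireT_argW]
  exact Iff.rfl

/-! #### Soundness: a feasible point certifies the output gate -/

/-- **Soundness of the collapse.** If the big SDP is feasible at `x` then the output gate `o` is
true at `x`: by strong induction along the program, `z_j > 0` forces gate `j` true (scale the
`j`-th block by `z_j⁻¹`; `w_{j,u}/z_j ≤ [u true]` by the `w`-rows and the induction hypothesis;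
`B ≥ 0`). -/
theorem getD_transcript_of_bigAcc
    (hD : ∀ (j : Fin C.gates.length) u, (C.gates[j]).op u = true ↔ (D j).Acc u)
    (o : Fin C.gates.length) (e : ι ≃ Fin (Fintype.card ι)) (x : ι → Bool)
    (h : BigAcc (D := D) o e (fun a => x (e.symm a))) :
    (transcript x [] C.gates).getD o false = true := by
  obtain ⟨Y, hY, hr⟩ := h
  rw [bigRows_iff] at hr
  obtain ⟨h1, h2, h3, h4, h5⟩ := hr
  set T := transcript x [] C.gates with hT
  -- the induction: `z_j > 0` forces gate `j` true
  have key : ∀ (n : ℕ) (hn : n < C.gates.length), 0 < Y (zI ⟨n, hn⟩) (zI ⟨n, hn⟩) →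
      T.getD n false = true := by
    intro n
    induction n using Nat.strong_induction_on with
    | _ n ih =>
      intro hn hz
      set j : Fin C.gates.length := ⟨n, hn⟩ with hj
      have hiff := getD_transcript_iff hD x j
      rw [← hT] at hiff
      apply hiff.2
      set c := (Y (zI j) (zI j))⁻¹ with hc
      have hc0 : 0 < c := inv_pos.2 hz
      have hcz : c * Y (zI j) (zI j) = 1 := inv_mul_cancel₀ hz.ne'
      -- the scaled `w`'s are below the true wire indicators
      have hw : ∀ a : Fin (C.gates[j]).arity,
          c * Y (wI j (argW j a)) (wI j (argW j a)) ≤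
            if wireT (C := C) x T (argW j a) then (1 : ℝ) else 0 := by
        intro a
        have hle : c * Y (wI j (argW j a)) (wI j (argW j a)) ≤ 1 := by
          calc c * Y (wI j (argW j a)) (wI j (argW j a)) ≤ c * Y (zI j) (zI j) :=
                mul_le_mul_of_nonneg_left (h2 j _) hc0.le
            _ = 1 := hcz
        have hlt : ∀ m' : Fin C.gates.length, argW j a = Sum.inr m' → (m' : ℕ) < n :=
          fun m' hm' => lt_of_argW_eq_inr hm'
        generalize argW j a = wa at hle hlt ⊢
        cases wa with
        | inl i =>
          by_cases hx : x i = true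
          · simp only [wireT, hx, if_true]
            exact hle
          · have h3' := h3 j i
            rw [if_neg hx] at h3'
            simp only [wireT, if_neg hx]
            nlinarith
        | inr m' =>
          have hmn : (m' : ℕ) < n := hlt m' rfl
          simp only [wireT]
          by_cases hTm : T.getD m' false = true
          · rw [if_pos hTm]
            exact hle
          · -- gate `m'` is false, so `z_{m'} ≤ 0` by induction, and `w ≤ z_{m'}`
            have hzm : Y (zI m') (zI m') ≤ 0 := by
              by_contra hpos
              push Not at hpos
              exact hTm (ih m' hmn m'.2 hpos)
            have h4' := h4 j m'
            rw [if_neg hTm]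
            nlinarith
      refine ⟨c • blk Y j, (hY.submatrix _).smul hc0.le, fun i => ?_⟩
      rw [Matrix.mul_smul, Matrix.trace_smul, smul_eq_mul]
      calc c * ((D j).A i * blk Y j).trace
          ≤ c * ((D j).b i * Y (zI j) (zI j) +
              ∑ a, (D j).B i a * Y (wI j (argW j a)) (wI j (argW j a))) :=
            mul_le_mul_of_nonneg_left (h1 j i) hc0.le
        _ = (D j).b i + ∑ a, (D j).B i a * (c * Y (wI j (argW j a)) (wI j (argW j a))) := by
            rw [mul_add, ← mul_assoc, mul_comm c, mul_assoc, hcz, mul_one, Finset.mul_sum]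
            refine congrArg _ (Finset.sum_congr rfl fun a _ => by ring)
        _ ≤ (D j).b i + ∑ a, (D j).B i a *
              (if wireT (C := C) x T (argW j a) then (1 : ℝ) else 0) :=
            add_le_add le_rfl (Finset.sum_le_sum fun a _ =>
              mul_le_mul_of_nonneg_left (hw a) ((D j).hB i a))
  exact key o o.2 (lt_of_lt_of_le one_pos h5)

/-! #### Completeness: the transcript gives a feasible point -/

section Completeness

variable (x : ι → Bool)

/-- The selection matrix of block `j`: `(Pm j)ᴴ M (Pm j)` places `M` on block `j`. -/
def Pm (j : Fin C.gates.length) : Matrix (Fin (D j).q) (QIdx C D) ℝ :=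
  Matrix.of fun u c => if c = bI j u then 1 else 0

omit [Fintype ι] in
theorem conj_apply (j : Fin C.gates.length) (M : Matrix (Fin (D j).q) (Fin (D j).q) ℝ)
    (c c' : QIdx C D) :
    ((Pm (D := D) j).conjTranspose * M * Pm (D := D) j) c c' =
      ∑ u, ∑ u', (if c = bI j u then (1 : ℝ) else 0) * M u u' * (if c' = bI j u' then 1 else 0) := by
  simp only [Matrix.mul_apply, Matrix.conjTranspose_apply, Pm, Matrix.of_apply, star_trivial,
    Finset.sum_mul]
  rw [Finset.sum_comm]

omit [Fintype ι] in
theorem conj_apply_bI (j : Fin C.gates.length) (M : Matrix (Fin (D j).q) (Fin (D j).q) ℝ)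
    (u u' : Fin (D j).q) :
    ((Pm (D := D) j).conjTranspose * M * Pm (D := D) j) (bI j u) (bI j u') = M u u' := by
  rw [conj_apply]
  simp

omit [Fintype ι] in
theorem conj_apply_of_ne (j : Fin C.gates.length) (M : Matrix (Fin (D j).q) (Fin (D j).q) ℝ)
    (c c' : QIdx C D) (hc : ∀ u, c ≠ bI j u) :
    ((Pm (D := D) j).conjTranspose * M * Pm (D := D) j) c c' = 0 := by
  rw [conj_apply]
  exact Finset.sum_eq_zero fun u _ => Finset.sum_eq_zero fun u' _ => by rw [if_neg (hc u)]; ring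

/-- A finite sum of positive semidefinite matrices is positive semidefinite. -/
theorem posSemidef_sum {α n' : Type*} [Fintype n'] (S : Finset α) (f : α → Matrix n' n' ℝ)
    (h : ∀ a ∈ S, (f a).PosSemidef) : (∑ a ∈ S, f a).PosSemidef := by
  classical
  induction S using Finset.induction_on with
  | empty => simpa using Matrix.PosSemidef.zero
  | insert a S ha ih =>
    rw [Finset.sum_insert ha]
    exact (h a (Finset.mem_insert_self a S)).add (ih fun b hb => h b (Finset.mem_insert_of_mem hb))

/-- Witness blocks: a feasible `Y_j` for every true gate, `0` for false gates. -/
def Yb (hD : ∀ (j : Fin C.gates.length) u, (C.gates[j]).op u = true ↔ (D j).Acc u) (j : Fin C.gates.length) : Matrix (Fin (D j).q) (Fin (D j).q) ℝ :=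
  if h : (transcript x [] C.gates).getD j false = true then
    ((getD_transcript_iff hD x j).1 h).choose else 0

omit [Fintype ι] [DecidableEq ι] in
theorem Yb_posSemidef (hD : ∀ (j : Fin C.gates.length) u, (C.gates[j]).op u = true ↔ (D j).Acc u) (j : Fin C.gates.length) : (Yb x hD j).PosSemidef := by
  unfold Yb
  split_ifs with h
  · exact ((getD_transcript_iff hD x j).1 h).choose_spec.1
  · exact Matrix.PosSemidef.zero

/-- Witness scalars: `z_j = [gate j true]`, `w_{j,u} = [gate j true ∧ wire u true]`. -/
def dvec : QIdx C D → ℝ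
  | .inl _ => 0
  | .inr (.inl j) => if (transcript x [] C.gates).getD j false = true then 1 else 0
  | .inr (.inr (j, u)) =>
      if (transcript x [] C.gates).getD j false = true ∧
          wireT (C := C) x (transcript x [] C.gates) u = true then 1 else 0

omit [Fintype ι] [DecidableEq ι] in
theorem dvec_nonneg (c : QIdx C D) : 0 ≤ dvec (C := C) (D := D) x c := by
  rcases c with _ | j | ⟨j, u⟩ <;> simp only [dvec] <;> try exact le_rfl
  all_goals split_ifs <;> norm_num

/-- **The witness**: blocks on the block-diagonal, scalars on the diagonal. -/
def Ybig (hD : ∀ (j : Fin C.gates.length) u, (C.gates[j]).op u = true ↔ (D j).Acc u) : Matrix (QIdx C D) (QIdx C D) ℝ :=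
  (∑ j, (Pm (D := D) j).conjTranspose * Yb x hD j * Pm (D := D) j) +
    Matrix.diagonal (dvec (C := C) (D := D) x)

theorem Ybig_posSemidef (hD : ∀ (j : Fin C.gates.length) u, (C.gates[j]).op u = true ↔ (D j).Acc u) : (Ybig x hD).PosSemidef := by
  refine Matrix.PosSemidef.add ?_ (Matrix.PosSemidef.diagonal fun c => dvec_nonneg x c)
  exact posSemidef_sum _ _ fun j _ => (Yb_posSemidef x hD j).conjTranspose_mul_mul_same _

omit [Fintype ι] in
theorem blk_Ybig (hD : ∀ (j : Fin C.gates.length) u, (C.gates[j]).op u = true ↔ (D j).Acc u) (j : Fin C.gates.length) : blk (Ybig x hD) j = Yb x hD j := by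
  ext u u'
  simp only [blk, Matrix.submatrix_apply, Ybig, Matrix.add_apply, Matrix.sum_apply,
    Matrix.diagonal_apply]
  rw [Finset.sum_eq_single j]
  · rw [conj_apply_bI]
    have : dvec (C := C) (D := D) x (bI j u) = 0 := rfl
    split_ifs <;> simp [this]
  · intro j' _ hj'
    exact conj_apply_of_ne j' _ _ _ fun u'' h => hj' (by
      simp only [bI, Sum.inl.injEq] at h
      exact (Sigma.mk.inj_iff.1 h).1.symm)
  · intro h; exact absurd (Finset.mem_univ j) h

omit [Fintype ι] in
theorem Ybig_inr (hD : ∀ (j : Fin C.gates.length) u, (C.gates[j]).op u = true ↔ (D j).Acc u) (c : Fin C.gates.length ⊕ (Fin C.gates.length × Wire C)) :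
    Ybig x hD (Sum.inr c) (Sum.inr c) = dvec (C := C) (D := D) x (Sum.inr c) := by
  simp only [Ybig, Matrix.add_apply, Matrix.sum_apply, Matrix.diagonal_apply_eq]
  rw [Finset.sum_eq_zero fun j _ => conj_apply_of_ne j _ _ _ fun u h => by simp [bI] at h, zero_add]

/-- **Completeness of the collapse.** If the output gate `o` is true at `x`, the big SDP is
feasible at `x`. -/
theorem bigAcc_of_getD_transcript (hD : ∀ (j : Fin C.gates.length) u, (C.gates[j]).op u = true ↔ (D j).Acc u) (o : Fin C.gates.length) (e : ι ≃ Fin (Fintype.card ι))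
    (h : (transcript x [] C.gates).getD o false = true) :
    BigAcc (D := D) o e (fun a => x (e.symm a)) := by
  refine ⟨Ybig x hD, Ybig_posSemidef x hD, ?_⟩
  rw [bigRows_iff]
  set T := transcript x [] C.gates with hT
  have hz : ∀ j : Fin C.gates.length, Ybig x hD (zI j) (zI j) = if T.getD j false = true then 1 else 0 :=
    fun j => Ybig_inr x hD (Sum.inl j)
  have hw : ∀ (j : Fin C.gates.length) (u : Wire C), Ybig x hD (wI j u) (wI j u) =
      if T.getD j false = true ∧ wireT (C := C) x T u = true then 1 else 0 :=
    fun j u => Ybig_inr x hD (Sum.inr (j, u))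
  refine ⟨fun j i => ?_, fun j u => ?_, fun j i => ?_, fun j m => ?_, ?_⟩
  · rw [blk_Ybig, hz]
    simp only [hw]
    by_cases hj : T.getD j false = true
    · have hspec := ((getD_transcript_iff hD x j).1 hj).choose_spec.2 i
      have hYb : Yb x hD j = ((getD_transcript_iff hD x j).1 hj).choose := by
        simp only [Yb, hT] at hj ⊢; rw [dif_pos hj]
      rw [hYb, if_pos hj, mul_one]
      refine hspec.trans (le_of_eq ?_)
      congr 1
      refine Finset.sum_congr rfl fun a _ => ?_
      rw [← hT]
      simp only [hj, true_and]
    · have hYb : Yb x hD j = 0 := by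
        simp only [Yb, hT] at hj ⊢; rw [dif_neg hj]
      rw [hYb, if_neg hj, Matrix.mul_zero, Matrix.trace_zero, mul_zero, zero_add]
      refine Finset.sum_nonneg fun a _ => mul_nonneg ((D j).hB i a) ?_
      split_ifs <;> norm_num
  · rw [hw, hz]
    split_ifs with h1 h2 <;>
      first | exact le_rfl | exact zero_le_one | exact absurd h1.1 h2
  · rw [hw]
    simp only [wireT]
    split_ifs with h1 h2 <;>
      first | exact le_rfl | exact zero_le_one | exact absurd h1.2 h2
  · rw [hw, hz]
    simp only [wireT]
    split_ifs with h1 h2 <;>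
      first | exact le_rfl | exact zero_le_one | exact absurd h1.2 h2
  · rw [hz, if_pos h]

end Completeness

/-- **Semantics of the collapsed gate**: it computes the output gate of the circuit. -/
theorem bigAcc_iff (hD : ∀ (j : Fin C.gates.length) u, (C.gates[j]).op u = true ↔ (D j).Acc u)
    (o : Fin C.gates.length) (e : ι ≃ Fin (Fintype.card ι)) (x : ι → Bool) :
    BigAcc (D := D) o e (fun a => x (e.symm a)) ↔ (transcript x [] C.gates).getD o false = true :=
  ⟨getD_transcript_of_bigAcc hD o e x, bigAcc_of_getD_transcript x hD o e⟩

/-! ### C.4 The collapse theorem and the single-gate form of the crux -/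

omit [Fintype ι] [DecidableEq ι] in
/-- A gate-free output (`C.output = inl i`) is the threshold gate `T¹₁ ∈ CONV₁` on `x_i`. -/
theorem thr_one_one_apply (x : ι → Bool) (i : ι) :
    (GateFn.thr 1 1).2 (fun _ => x i) = x i := by
  simp only [GateFn.thr, GateFn.numOnes]
  cases x i <;> simp

open scoped Classical in
/-- **COLLAPSE THEOREM.** Every circuit over `{∧₂, ∨₂} ∪ CONV_s` with `t` gates on `n` inputs is
computed by ONE CONV gate of width `collapseWidth t (max s 1) n = t·max(s,1) + t + 3t(n+t) + 1`. -/
theorem exists_gate_of_isOver (C : Circuit ι) (hC : C.IsOver (basis s)) :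
    ∃ (g : GateFn) (w : Fin g.1 → ι),
      IsConvGate (collapseWidth C.size (max s 1) (Fintype.card ι)) g ∧
        ∀ x, g.2 (fun a => x (w a)) = C.eval x := by
  -- every gate is a CONV gate of width `max s 1`
  have hconv : ∀ j : Fin C.gates.length, IsConvGate (max s 1) (C.gates[j]).fn := by
    intro j
    have hg := hC _ (List.getElem_mem j.2)
    rcases hg with hg | hg
    · rcases hg with hg | hg
      · have hg' : (C.gates[j]).fn = GateFn.and 2 := hg
        rw [hg']
        exact (and_isConvGate 2).mono (le_max_right _ _)
      · have hg' : (C.gates[j]).fn = GateFn.or 2 := hg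
        rw [hg']
        exact (or_isConvGate 2).mono (le_max_right _ _)
    · exact IsConvGate.mono hg (le_max_left _ _)
  obtain ⟨D, hD⟩ : ∃ D : ∀ j : Fin C.gates.length, ConvData (C.gates[j]).arity (max s 1),
      ∀ (j : Fin C.gates.length) (u : Fin (C.gates[j]).arity → Bool),
        (C.gates[j]).op u = true ↔ (D j).Acc u :=
    ⟨fun j => (exists_convData (hconv j)).choose, fun j => (exists_convData (hconv j)).choose_spec⟩
  have h1 : 1 ≤ collapseWidth C.size (max s 1) (Fintype.card ι) := by
    unfold collapseWidth; omega
  cases ho : C.output with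
  | inl i =>
    refine ⟨GateFn.thr 1 1, fun _ => i, (thr_isConvGate 1 1).mono h1, fun x => ?_⟩
    rw [thr_one_one_apply, eval_eq_wireVal, ho]
    rfl
  | inr o =>
    have ho' : o < C.gates.length := C.wf_output o ho
    let e := Fintype.equivFin ι
    refine ⟨bigGate (D := D) ⟨o, ho'⟩ e, fun a => e.symm a, bigGate_isConvGate _ _, fun x => ?_⟩
    rw [eval_eq_wireVal, ho]
    show decide (BigAcc (D := D) ⟨o, ho'⟩ e fun a => x (e.symm a)) =
      (transcript x [] C.gates).getD o false
    rw [Bool.eq_iff_iff, decide_eq_true_iff, bigAcc_iff hD]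

/-- The same, as a one-gate circuit. -/
theorem exists_oneGate_circuit_of_isOver (C : Circuit ι) (hC : C.IsOver (basis s)) :
    ∃ C' : Circuit ι, C'.IsOver (Conv (collapseWidth C.size (max s 1) (Fintype.card ι))) ∧
      C'.size = 1 ∧ ∀ x, C'.eval x = C.eval x := by
  obtain ⟨g, w, hg, hcomp⟩ := exists_gate_of_isOver C hC
  exact ⟨oneGate g w, isOver_oneGate hg w, rfl, fun x => by rw [eval_oneGate, hcomp]⟩

end Collapse

section SingleGate

/-- A crude polynomial bound for the collapse width. -/
theorem collapseWidth_le (t s n : ℕ) : collapseWidth t s n ≤ 6 * (t + s + n + 1) ^ 2 := by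
  unfold collapseWidth
  nlinarith [Nat.zero_le t, Nat.zero_le s, Nat.zero_le n, Nat.zero_le (t * s), Nat.zero_le (t * n)]

/-- `GateHard δ c m`: no single CONV gate of width `≤ m^c`, wired to the edge variables, computes
`CLIQUE(m, ⌈m^δ⌉₊)`. -/
def GateHard (δ : ℝ) (c m : ℕ) : Prop :=
  ∀ g : GateFn, IsConvGate (m ^ c) g → ∀ w : Fin g.1 → E m,
    ¬ ∀ x, g.2 (fun a => x (w a)) = cliqueFn m ⌈(m : ℝ) ^ δ⌉₊ x

/-- The single-gate form of the crux. -/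
def SingleGateHard (δ : ℝ) : Prop := ∀ c : ℕ, ∀ᶠ m : ℕ in atTop, GateHard δ c m

/-- Circuits are at least as strong as single gates (`m ≥ 1`). -/
theorem gateHard_of_hard {δ : ℝ} {c m : ℕ} (hm : 1 ≤ m) (h : Hard δ c m) : GateHard δ c m := by
  intro g hg w hcomp
  exact h (oneGate g w) (isOver_oneGate (Or.inr hg) w)
    (by rw [size_oneGate]; exact Nat.one_le_pow _ _ hm) fun x => by rw [eval_oneGate, hcomp x]

/-- Width bookkeeping: for `m ≥ 2`, a circuit of size `≤ m^c` over `basis (m^c)` on the `≤ m²`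
edge variables collapses to a gate of width `≤ m^(2c+11)`. -/
theorem collapseWidth_clique_le {m c t : ℕ} (hm : 2 ≤ m) (ht : t ≤ m ^ c) :
    collapseWidth t (max (m ^ c) 1) (Fintype.card (E m)) ≤ m ^ (2 * c + 11) := by
  have h1 : 1 ≤ m := by omega
  have hmax : max (m ^ c) 1 = m ^ c := max_eq_left (Nat.one_le_pow _ _ h1)
  have hE : Fintype.card (E m) ≤ m ^ 2 := CliqueLPGate.nE_le m
  have hc2 : m ^ c ≤ m ^ (c + 2) := Nat.pow_le_pow_right h1 (by omega)
  have h22 : m ^ 2 ≤ m ^ (c + 2) := Nat.pow_le_pow_right h1 (by omega)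
  have h12 : 1 ≤ m ^ (c + 2) := Nat.one_le_pow _ _ h1
  have hX : t + max (m ^ c) 1 + Fintype.card (E m) + 1 ≤ 4 * m ^ (c + 2) := by
    rw [hmax]; omega
  have h96 : 96 ≤ m ^ 7 := by
    calc 96 ≤ 2 ^ 7 := by norm_num
      _ ≤ m ^ 7 := Nat.pow_le_pow_left hm 7
  calc collapseWidth t (max (m ^ c) 1) (Fintype.card (E m))
      ≤ 6 * (t + max (m ^ c) 1 + Fintype.card (E m) + 1) ^ 2 := collapseWidth_le _ _ _
    _ ≤ 6 * (4 * m ^ (c + 2)) ^ 2 := by gcongr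
    _ = 96 * (m ^ (c + 2)) ^ 2 := by ring
    _ ≤ m ^ 7 * (m ^ (c + 2)) ^ 2 := Nat.mul_le_mul_right _ h96
    _ = m ^ (2 * c + 11) := by rw [← pow_mul, ← pow_add]; ring_nf

/-- **THE CRUX IS ITS SINGLE-GATE CASE.** `CliqueHard δ ↔ SingleGateHard δ`: a lower bound
against polynomial `{∧₂, ∨₂} ∪ CONV` CIRCUITS is the same as a lower bound against ONE
polynomial-width monotone SDP-feasibility gate (a psd-lift lower bound for an up-closed convex
separator of the `k`-clique indicators from the `k`-clique-free graphs). -/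
theorem cliqueHard_iff_singleGateHard (δ : ℝ) : CliqueHard δ ↔ SingleGateHard δ := by
  constructor
  · intro h c
    filter_upwards [h c, eventually_ge_atTop 1] with m hm h1
    exact gateHard_of_hard h1 hm
  · intro h c
    filter_upwards [h (2 * c + 11), eventually_ge_atTop 2] with m hm h2 C hC hsz hcomp
    obtain ⟨g, w, hg, hgc⟩ := exists_gate_of_isOver C hC
    refine hm g (hg.mono ((Nat.le_of_eq ?_).trans (collapseWidth_clique_le h2 hsz))) w
      fun x => by rw [hgc x, hcomp x]
    rfl

/-- **Read-back, single-gate form**: the crux `ConvexGateBlind` is equivalent to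
`∃ δ ∈ (0, 1/2), ∀ c, ∀ᶠ m, no ONE CONV gate of width ≤ m^c computes CLIQUE(m, ⌈m^δ⌉₊)`. A
refutation of the crux is therefore exactly a polynomial-width monotone SDP-feasibility
description of CLIQUE(m, m^δ) for infinitely many m (for every δ). -/
theorem convexGateBlind_iff_singleGate :
    ConvexGateBlind ↔ ∃ δ : ℝ, 0 < δ ∧ δ < 1 / 2 ∧ SingleGateHard δ := by
  rw [convexGateBlind_iff]
  simp only [cliqueHard_iff_singleGateHard]

/-! ### C.5 Normal form: data on the edge variables (wiring absorbed into `B`) -/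

/-- `DataHard δ c m`: no CONV data `(p, q ≤ m^c; A, b, B ≥ 0)` over the edge variables themselves
(arity `#E(K_m)`, identity wiring `eE`) accepts exactly the graphs containing a `⌈m^δ⌉₊`-clique —
i.e. no monotone projected spectrahedron `{x : ∃ Y ⪰ 0, tr(Aᵢ Y) ≤ bᵢ + (B x)ᵢ}` of that width cuts
out `CLIQUE(m, ⌈m^δ⌉₊)⁻¹(1)` from the cube. -/
def DataHard (δ : ℝ) (c m : ℕ) : Prop :=
  ∀ D : ConvData (CliqueLPGate.nE m) (m ^ c),
    ¬ ∀ x : E m → Bool, (D.Acc (fun a => x ((CliqueLPGate.eE m).symm a)) ↔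
      cliqueFn m ⌈(m : ℝ) ^ δ⌉₊ x = true)

open scoped Classical in
/-- CONV data define a CONV gate (of the same width). -/
theorem ConvData.isConvGate {k s : ℕ} (D : ConvData k s) :
    IsConvGate s ⟨k, fun v => decide (D.Acc v)⟩ :=
  ⟨D.p, D.q, D.hpq, D.A, D.b, D.B, D.hB, fun _ => decide_eq_true_iff⟩

/-- **Rewiring.** The data of a gate wired by `w` to the edges can be pushed onto the edge
variables: merge the `B`-columns of arguments reading the same edge. -/
def ConvData.rewire {m k s : ℕ} (D : ConvData k s) (w : Fin k → E m) :
    ConvData (CliqueLPGate.nE m) s where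
  p := D.p
  q := D.q
  hpq := D.hpq
  A := D.A
  b := D.b
  B := fun i e' => ∑ a ∈ Finset.univ.filter (fun a => CliqueLPGate.eE m (w a) = e'), D.B i a
  hB := fun i _ => Finset.sum_nonneg fun a _ => D.hB i a

theorem ConvData.rewire_acc_iff {m k s : ℕ} (D : ConvData k s) (w : Fin k → E m) (x : E m → Bool) :
    (D.rewire w).Acc (fun a => x ((CliqueLPGate.eE m).symm a)) ↔ D.Acc (fun a => x (w a)) := by
  have hrhs : ∀ i, (∑ e', (D.rewire w).B i e' *
      (if x ((CliqueLPGate.eE m).symm e') then (1 : ℝ) else 0)) =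
        ∑ a, D.B i a * (if x (w a) then (1 : ℝ) else 0) := by
    intro i
    simp only [ConvData.rewire, Finset.sum_mul]
    rw [← Finset.sum_fiberwise (s := Finset.univ) (g := fun a => CliqueLPGate.eE m (w a))
      (f := fun a => D.B i a * (if x (w a) then (1 : ℝ) else 0))]
    refine Finset.sum_congr rfl fun e' _ => Finset.sum_congr rfl fun a ha => ?_
    have hwa : w a = (CliqueLPGate.eE m).symm e' := by
      rw [← (Finset.mem_filter.1 ha).2, Equiv.symm_apply_apply]
    rw [hwa]
  simp only [ConvData.Acc, hrhs]
  rfl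

/-- **Gates versus data**: `GateHard δ c m ↔ DataHard δ c m`. -/
theorem gateHard_iff_dataHard (δ : ℝ) (c m : ℕ) : GateHard δ c m ↔ DataHard δ c m := by
  constructor
  · intro h D hD
    refine h _ D.isConvGate (fun a => (CliqueLPGate.eE m).symm a) fun x => ?_
    show @decide (D.Acc fun a => x ((CliqueLPGate.eE m).symm a)) (Classical.propDecidable _) = _
    rw [Bool.eq_iff_iff, @decide_eq_true_iff, hD x]
  · intro h g hg w hcomp
    obtain ⟨D, hD⟩ := exists_convData hg
    refine h (D.rewire w) fun x => ?_
    rw [ConvData.rewire_acc_iff, ← hD, hcomp x]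

/-- **Read-back, data form**: the crux is equivalent to `∃ δ ∈ (0,1/2), ∀ c, ∀ᶠ m, DataHard δ c m`
— no monotone SDP-feasibility description of width `≤ m^c` of the `⌈m^δ⌉₊`-clique graphs. -/
theorem convexGateBlind_iff_data :
    ConvexGateBlind ↔ ∃ δ : ℝ, 0 < δ ∧ δ < 1 / 2 ∧ ∀ c : ℕ, ∀ᶠ m : ℕ in atTop, DataHard δ c m := by
  rw [convexGateBlind_iff_singleGate]
  simp only [SingleGateHard, gateHard_iff_dataHard]

end SingleGate

/-! ## §E MONOTONICITY IN `δ`: hardness propagates upward, refutations downward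

Apex padding: `CLIQUE(m', k')` is the restriction of `CLIQUE(m, k' + (m - m'))` obtained by
switching on every edge at the `m - m'` new vertices, and a restriction of CONV data is CONV data
of the same width (dead columns of `B` move into `b`). With the discrete intermediate value
theorem for `j ↦ j - ⌈j^δ'⌉₊` this gives `CliqueHard δ' → CliqueHard δ` for `0 < δ' ≤ δ < 1`.
Consequences: the crux implies `CliqueHard δ` for EVERY `δ ∈ [1/2, 1)`, and it is KILLED by
beating it at any single exponent `δ ∈ [1/2, 1)` — e.g. at the planted-clique threshold
`k = ⌈√m⌉`.
-/

section DeltaMono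

/-! ### E.1 Apex padding of the clique function -/

variable {m' m : ℕ} (hm : m' ≤ m)

/-- The edge of `K_m` over an edge of `K_{m'}` (`m' ≤ m`, vertices embedded by `Fin.castLE`). -/
def embE (e : E m') : E m :=
  ⟨(e : Sym2 (Fin m')).map (Fin.castLE hm), by
    obtain ⟨e, he⟩ := e
    induction e using Sym2.ind with
    | h a b =>
      have hab : a ≠ b := (SimpleGraph.top_adj a b).1 ((SimpleGraph.mem_edgeSet ⊤).1 he)
      rw [Sym2.map_mk, SimpleGraph.mem_edgeSet, SimpleGraph.top_adj]
      exact fun h => hab (Fin.castLE_injective hm h)⟩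

theorem embE_injective : Function.Injective (embE hm) := by
  intro e₁ e₂ h
  apply Subtype.ext
  have h' := congrArg Subtype.val h
  exact Sym2.map.injective (Fin.castLE_injective hm) h'

open scoped Classical in
/-- Extension of an edge vector of `K_{m'}` to `K_m`: live edges keep their value, every edge at
an apex vertex is switched on. -/
def extV (x' : E m' → Bool) (e : E m) : Bool :=
  decide ((∃ e', embE hm e' = e ∧ x' e' = true) ∨ ¬ ∃ e', embE hm e' = e)

theorem extV_embE (x' : E m' → Bool) (e' : E m') : extV hm x' (embE hm e') = x' e' := by
  classical
  unfold extV
  rw [Bool.eq_iff_iff, decide_eq_true_iff]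
  constructor
  · rintro (⟨e'', he, hx⟩ | h)
    · rwa [← embE_injective hm he]
    · exact absurd ⟨e', rfl⟩ h
  · intro hx
    exact Or.inl ⟨e', rfl, hx⟩

theorem extV_of_not_range (x' : E m' → Bool) (e : E m) (he : ∀ e', embE hm e' ≠ e) :
    extV hm x' e = true := by
  classical
  unfold extV
  rw [decide_eq_true_iff]
  exact Or.inr fun ⟨e', h⟩ => he e' h

/-- An edge of `K_m` both of whose endpoints are live is in the range of `embE`. -/
theorem exists_embE_of_lt {u v : Fin m} (huv : s(u, v) ∈ (⊤ : SimpleGraph (Fin m)).edgeSet)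
    (hu : (u : ℕ) < m') (hv : (v : ℕ) < m') : ∃ e', embE hm e' = ⟨s(u, v), huv⟩ := by
  have hne : u ≠ v := (SimpleGraph.top_adj u v).1 ((SimpleGraph.mem_edgeSet ⊤).1 huv)
  have hne' : (⟨u, hu⟩ : Fin m') ≠ ⟨v, hv⟩ := fun h => hne (Fin.ext (Fin.mk.inj_iff.1 h))
  refine ⟨⟨s(⟨u, hu⟩, ⟨v, hv⟩), (SimpleGraph.mem_edgeSet ⊤).2 ((SimpleGraph.top_adj _ _).2 hne')⟩,
    Subtype.ext ?_⟩
  simp [embE, Fin.castLE]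

/-- An edge in the range of `embE` has live endpoints. -/
theorem lt_of_embE_eq {u v : Fin m} {huv : s(u, v) ∈ (⊤ : SimpleGraph (Fin m)).edgeSet}
    {e' : E m'} (h : embE hm e' = ⟨s(u, v), huv⟩) : (u : ℕ) < m' ∧ (v : ℕ) < m' := by
  obtain ⟨e', he'⟩ := e'
  induction e' using Sym2.ind with
  | h a b =>
    have h' := congrArg Subtype.val h
    simp only [embE, Sym2.map_mk] at h'
    rcases Sym2.eq_iff.1 h' with ⟨rfl, rfl⟩ | ⟨rfl, rfl⟩
    · exact ⟨a.2, b.2⟩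
    · exact ⟨b.2, a.2⟩

/-- **Apex padding.** `CLIQUE(m, k' + (m - m'))` on the extended vector is `CLIQUE(m', k')`. -/
theorem cliqueFn_extV (x' : E m' → Bool) (k' : ℕ) :
    cliqueFn m (k' + (m - m')) (extV hm x') = cliqueFn m' k' x' := by
  classical
  rw [Bool.eq_iff_iff, CliqueLPGate.cliqueFn_eq_true_iff_exists,
    CliqueLPGate.cliqueFn_eq_true_iff_exists]
  -- the apex (dead) vertices
  set Dd : Finset (Fin m) := Finset.univ.filter fun v => m' ≤ (v : ℕ) with hDd
  have hDcard : Dd.card = m - m' := by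
    have h1 : Dd = Finset.univ \ Finset.univ.map (Fin.castLEEmb hm) := by
      ext v
      simp only [hDd, Finset.mem_filter, Finset.mem_univ, true_and, Finset.mem_sdiff,
        Finset.mem_map, Fin.castLEEmb_apply, not_exists]
      constructor
      · intro hv a ha
        have : ((Fin.castLE hm a : Fin m) : ℕ) = v := by rw [ha]
        simp at this; omega
      · intro h
        by_contra hlt
        push Not at hlt
        exact h ⟨v, hlt⟩ (Fin.ext rfl)
    rw [h1, Finset.card_sdiff_of_subset (Finset.subset_univ _), Finset.card_map, Finset.card_univ,
      Finset.card_univ, Fintype.card_fin, Fintype.card_fin]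
  constructor
  · -- a clique of the padded graph restricts to a clique of the live part
    rintro ⟨S, hS, hx⟩
    set T : Finset (Fin m') := Finset.univ.filter fun a => Fin.castLE hm a ∈ S with hT
    have hTcard : k' ≤ T.card := by
      -- `S ⊆ image T ∪ Dd`
      have hsub : S ⊆ T.map (Fin.castLEEmb hm) ∪ Dd := by
        intro v hv
        by_cases hlt : (v : ℕ) < m'
        · refine Finset.mem_union_left _ (Finset.mem_map.2 ⟨⟨v, hlt⟩, ?_, Fin.ext rfl⟩)
          simp only [hT, Finset.mem_filter, Finset.mem_univ, true_and]
          have : Fin.castLE hm ⟨v, hlt⟩ = v := Fin.ext rfl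
          rwa [this]
        · exact Finset.mem_union_right _ (by simp [hDd]; omega)
      have := (Finset.card_le_card hsub).trans (Finset.card_union_le _ _)
      rw [Finset.card_map, hDcard, hS] at this
      omega
    obtain ⟨T₀, hT₀T, hT₀⟩ := Finset.exists_subset_card_eq hTcard
    refine ⟨T₀, hT₀, fun e' he' => ?_⟩
    obtain ⟨e', heE⟩ := e'
    induction e' using Sym2.ind with
    | h a b =>
      have ha : Fin.castLE hm a ∈ S := by
        have := hT₀T (he' a (Sym2.mem_mk_left a b)); simp [hT] at this; exact this
      have hb : Fin.castLE hm b ∈ S := by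
        have := hT₀T (he' b (Sym2.mem_mk_right a b)); simp [hT] at this; exact this
      rw [← extV_embE hm x']
      refine hx _ fun y hy => ?_
      simp only [embE, Sym2.map_mk, Sym2.mem_iff] at hy
      rcases hy with rfl | rfl
      · exact ha
      · exact hb
  · -- a live clique plus all apexes is a clique of the padded graph
    rintro ⟨T, hT, hx⟩
    refine ⟨T.map (Fin.castLEEmb hm) ∪ Dd, ?_, fun e he => ?_⟩
    · rw [Finset.card_union_of_disjoint, Finset.card_map, hT, hDcard]
      rw [Finset.disjoint_left]
      intro v hv hvD
      obtain ⟨a, -, rfl⟩ := Finset.mem_map.1 hv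
      simp [hDd, Fin.castLEEmb] at hvD
      exact absurd a.2 (not_lt.2 hvD)
    · obtain ⟨e, heE⟩ := e
      induction e using Sym2.ind with
      | h u v =>
        by_cases hlive : (u : ℕ) < m' ∧ (v : ℕ) < m'
        · obtain ⟨e', he'⟩ := exists_embE_of_lt hm heE hlive.1 hlive.2
          rw [← he', extV_embE]
          apply hx
          intro y hy
          -- endpoints of `e'` are the live preimages of `u, v`, which lie in `T`
          have hu := he _ (Sym2.mem_mk_left u v)
          have hv := he _ (Sym2.mem_mk_right u v)
          have key : ∀ w : Fin m, w ∈ T.map (Fin.castLEEmb hm) ∪ Dd → (w : ℕ) < m' →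
              ∀ a : Fin m', Fin.castLE hm a = w → a ∈ T := by
            intro w hw hwlt a ha
            rcases Finset.mem_union.1 hw with hw | hw
            · obtain ⟨a', ha', rfl⟩ := Finset.mem_map.1 hw
              have : a = a' := Fin.castLE_injective hm (by rw [ha]; rfl)
              rwa [this]
            · simp [hDd] at hw; omega
          obtain ⟨e'v, he'E⟩ := e'
          induction e'v using Sym2.ind with
          | h a b =>
            have h' := congrArg Subtype.val he'
            simp only [embE, Sym2.map_mk] at h'
            simp only [Sym2.mem_iff] at hy
            rcases Sym2.eq_iff.1 h' with ⟨hau, hbv⟩ | ⟨hav, hbu⟩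
            · rcases hy with rfl | rfl
              · exact key u hu hlive.1 _ hau
              · exact key v hv hlive.2 _ hbv
            · rcases hy with rfl | rfl
              · exact key v hv hlive.2 _ hav
              · exact key u hu hlive.1 _ hbu
        · apply extV_of_not_range
          intro e' h
          exact hlive (lt_of_embE_eq hm h)

/-! ### E.2 Restriction of CONV data along the padding -/

/-- Positions (in the enumeration `eE m`) of the live edges. -/
def livePos (a' : Fin (CliqueLPGate.nE m')) : Fin (CliqueLPGate.nE m) :=
  CliqueLPGate.eE m (embE hm ((CliqueLPGate.eE m').symm a'))

theorem livePos_injective : Function.Injective (livePos hm) := by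
  intro a b h
  simpa [livePos, (embE_injective hm).eq_iff] using h

/-- **Restriction of data**: dead `B`-columns (apex edges, switched on) are absorbed into `b`,
live columns are re-indexed; the width is unchanged. -/
def ConvData.pad {s : ℕ} (D : ConvData (CliqueLPGate.nE m) s) : ConvData (CliqueLPGate.nE m') s where
  p := D.p
  q := D.q
  hpq := D.hpq
  A := D.A
  b := fun i => D.b i + ∑ a ∈ Finset.univ.filter (fun a => ∀ a', livePos hm a' ≠ a), D.B i a
  B := fun i a' => D.B i (livePos hm a')
  hB := fun i _ => D.hB i _

theorem ConvData.pad_acc_iff {s : ℕ} (D : ConvData (CliqueLPGate.nE m) s) (x' : E m' → Bool) :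
    (D.pad hm).Acc (fun a' => x' ((CliqueLPGate.eE m').symm a')) ↔
      D.Acc (fun a => extV hm x' ((CliqueLPGate.eE m).symm a)) := by
  classical
  have hrhs : ∀ i, D.b i + ∑ a, D.B i a *
      (if extV hm x' ((CliqueLPGate.eE m).symm a) then (1 : ℝ) else 0) =
      (D.pad hm).b i + ∑ a', (D.pad hm).B i a' *
        (if x' ((CliqueLPGate.eE m').symm a') then (1 : ℝ) else 0) := by
    intro i
    simp only [ConvData.pad]
    rw [add_assoc, add_left_cancel_iff]
    rw [← Finset.sum_filter_add_sum_filter_not Finset.univ (fun a => ∀ a', livePos hm a' ≠ a)]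
    congr 1
    · refine Finset.sum_congr rfl fun a ha => ?_
      have ha' := (Finset.mem_filter.1 ha).2
      rw [extV_of_not_range, if_pos rfl, mul_one]
      intro e' he
      apply ha' (CliqueLPGate.eE m' e')
      simp [livePos, he]
    · have hset : Finset.univ.filter (fun a => ¬ ∀ a', livePos hm a' ≠ a) =
          Finset.univ.image (livePos hm) := by
        ext a
        simp only [Finset.mem_filter, Finset.mem_univ, true_and, Finset.mem_image, not_forall,
          not_not]
      rw [hset, Finset.sum_image fun a _ b _ h => livePos_injective hm h]
      refine Finset.sum_congr rfl fun a' _ => ?_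
      simp only [livePos, Equiv.symm_apply_apply, extV_embE]
  simp only [ConvData.Acc, hrhs]
  exact Iff.rfl

/-- Widening the width bound of CONV data. -/
def ConvData.widen {k s s' : ℕ} (D : ConvData k s) (h : s ≤ s') : ConvData k s' :=
  ⟨D.p, D.q, D.hpq.trans h, D.A, D.b, D.B, D.hB⟩

theorem ConvData.widen_acc_iff {k s s' : ℕ} (D : ConvData k s) (h : s ≤ s') (u : Fin k → Bool) :
    (D.widen h).Acc u ↔ D.Acc u := Iff.rfl

/-! ### E.3 The exponent bookkeeping -/

/-- Discrete intermediate value theorem for a function with steps `≤ 1` starting at `0`. -/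
theorem exists_eq_of_step_le_one {f : ℕ → ℕ} (h0 : f 0 = 0) (hstep : ∀ j, f (j + 1) ≤ f j + 1) :
    ∀ N v, v ≤ f N → ∃ j ≤ N, f j = v := by
  intro N
  induction N with
  | zero => intro v hv; exact ⟨0, le_rfl, by omega⟩
  | succ N ih =>
    intro v hv
    by_cases h : v ≤ f N
    · obtain ⟨j, hj, hfj⟩ := ih v h
      exact ⟨j, by omega, hfj⟩
    · exact ⟨N + 1, le_rfl, by have := hstep N; omega⟩

theorem rpow_succ_le_rpow_add_one (j : ℕ) {δ : ℝ} (h0 : 0 ≤ δ) (h1 : δ ≤ 1) :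
    ((j : ℝ) + 1) ^ δ ≤ (j : ℝ) ^ δ + 1 := by
  have h := NNReal.rpow_add_le_add_rpow (j : NNReal) 1 h0 h1
  have h' := NNReal.coe_le_coe.2 h
  simp only [NNReal.coe_rpow, NNReal.coe_add, NNReal.coe_natCast, NNReal.coe_one,
    NNReal.one_rpow] at h'
  exact h'

/-- `⌈0^δ⌉₊ = 0` for `δ > 0`. -/
theorem ceil_zero_rpow {δ : ℝ} (h0 : 0 < δ) : ⌈((0 : ℕ) : ℝ) ^ δ⌉₊ = 0 := by
  rw [Nat.cast_zero, Real.zero_rpow h0.ne', Nat.ceil_zero]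

/-- The defect `j ↦ j - ⌈j^δ⌉₊` takes every value up to its value at `N`. -/
theorem exists_sub_ceil_eq {δ : ℝ} (h0 : 0 < δ) (h1 : δ ≤ 1) (N v : ℕ)
    (hv : v ≤ N - ⌈(N : ℝ) ^ δ⌉₊) : ∃ j ≤ N, j - ⌈(j : ℝ) ^ δ⌉₊ = v := by
  refine exists_eq_of_step_le_one (f := fun j => j - ⌈(j : ℝ) ^ δ⌉₊) (by simp)
    (fun j => ?_) N v hv
  have hcj : ⌈(j : ℝ) ^ δ⌉₊ ≤ j := by
    rcases Nat.eq_zero_or_pos j with rfl | hj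
    · rw [ceil_zero_rpow h0]
    · exact ceil_rpow_le h1 hj
  have hmono : ⌈(j : ℝ) ^ δ⌉₊ ≤ ⌈((j + 1 : ℕ) : ℝ) ^ δ⌉₊ :=
    Nat.ceil_mono (Real.rpow_le_rpow (Nat.cast_nonneg _) (by push_cast; linarith) h0.le)
  show (j + 1) - ⌈((j + 1 : ℕ) : ℝ) ^ δ⌉₊ ≤ (j - ⌈(j : ℝ) ^ δ⌉₊) + 1
  omega

/-- Eventually `2·(⌈m^δ⌉₊ + 1) ≤ m` for `δ < 1`. -/
theorem eventually_two_mul_ceil_rpow_le {δ : ℝ} (h1 : δ < 1) :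
    ∀ᶠ m : ℕ in atTop, 2 * (⌈(m : ℝ) ^ δ⌉₊ + 1) ≤ m := by
  have hpos : 0 < 1 - δ := by linarith
  set R : ℝ := (4 : ℝ) ^ (1 / (1 - δ)) with hR
  filter_upwards [eventually_ge_atTop (max 8 ⌈R⌉₊)] with m hm
  have hm8 : 8 ≤ m := le_of_max_le_left hm
  have hmR : R ≤ m := (Nat.le_ceil R).trans (by exact_mod_cast le_of_max_le_right hm)
  have hm0 : (0 : ℝ) < m := by exact_mod_cast (show 0 < m by omega)
  -- `m^(1-δ) ≥ 4`
  have h4 : (4 : ℝ) ≤ (m : ℝ) ^ (1 - δ) := by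
    calc (4 : ℝ) = R ^ (1 - δ) := by
          rw [hR, ← Real.rpow_mul (by norm_num), one_div, inv_mul_cancel₀ hpos.ne', Real.rpow_one]
      _ ≤ (m : ℝ) ^ (1 - δ) := Real.rpow_le_rpow (by positivity) hmR hpos.le
  -- hence `m^δ ≤ m/4`
  have hδ : (m : ℝ) ^ δ ≤ m / 4 := by
    have hsplit : (m : ℝ) = (m : ℝ) ^ δ * (m : ℝ) ^ (1 - δ) := by
      rw [← Real.rpow_add hm0, add_sub_cancel, Real.rpow_one]
    rw [le_div_iff₀ (by norm_num : (0 : ℝ) < 4)]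
    calc (m : ℝ) ^ δ * 4 ≤ (m : ℝ) ^ δ * (m : ℝ) ^ (1 - δ) :=
          mul_le_mul_of_nonneg_left h4 (by positivity)
      _ = m := hsplit.symm
  have hceil : (⌈(m : ℝ) ^ δ⌉₊ : ℝ) < (m : ℝ) ^ δ + 1 := Nat.ceil_lt_add_one (by positivity)
  have hreal : (2 : ℝ) * (⌈(m : ℝ) ^ δ⌉₊ + 1) ≤ m := by
    have : (8 : ℝ) ≤ m := by exact_mod_cast hm8
    linarith
  exact_mod_cast hreal

/-! ### E.4 Monotonicity of the data form, and of `CliqueHard` -/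

/-- One bad `m` for `(δ, c)` gives a bad `m' ≥ m/2` for `(δ', c+1)` (`0 < δ' ≤ δ < 1`). -/
theorem not_dataHard_pad {δ' δ : ℝ} (h0 : 0 < δ') (hle : δ' ≤ δ) (h1 : δ < 1) {c m : ℕ}
    (hm2 : 2 * (⌈(m : ℝ) ^ δ⌉₊ + 1) ≤ m) (hmc : 2 ^ (c + 1) ≤ m) (hbad : ¬ DataHard δ c m) :
    ∃ m', m ≤ 2 * m' ∧ ¬ DataHard δ' (c + 1) m' := by
  have hδ0 : 0 < δ := h0.trans_le hle
  set k := ⌈(m : ℝ) ^ δ⌉₊ with hk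
  have hm1 : 1 ≤ m := by omega
  have hkm : k ≤ m := by omega
  -- choose `m'` with `m' - ⌈m'^δ'⌉₊ = m - k`
  have hv : m - k ≤ m - ⌈(m : ℝ) ^ δ'⌉₊ := by
    apply Nat.sub_le_sub_left
    exact Nat.ceil_mono (Real.rpow_le_rpow_of_exponent_le (by exact_mod_cast hm1) hle)
  obtain ⟨m', hm'm, hm'⟩ := exists_sub_ceil_eq h0 (hle.trans h1.le) m (m - k) hv
  set k' := ⌈(m' : ℝ) ^ δ'⌉₊ with hk'
  have hm'pos : 1 ≤ m' := by
    by_contra h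
    have h0' : m' = 0 := by omega
    rw [h0'] at hm'
    simp at hm'
    omega
  have hk'm' : k' ≤ m' := ceil_rpow_le (hle.trans h1.le) hm'pos
  have hkk' : k = k' + (m - m') := by omega
  have h2m' : m ≤ 2 * m' := by omega
  refine ⟨m', h2m', fun hgood => hbad fun D hD => ?_⟩
  -- width: `m^c ≤ m'^(c+1)`
  have hwidth : m ^ c ≤ m' ^ (c + 1) := by
    have h3 : m ^ (c + 1) ≤ (2 * m') ^ (c + 1) := Nat.pow_le_pow_left h2m' _
    rw [Nat.mul_pow, pow_succ m] at h3
    have h4 : 2 ^ (c + 1) * m ^ c ≤ m ^ c * m := by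
      rw [mul_comm]; exact Nat.mul_le_mul_left _ hmc
    exact Nat.le_of_mul_le_mul_left (h4.trans h3) (by positivity)
  refine hgood ((D.pad hm'm).widen hwidth) fun x' => ?_
  rw [ConvData.widen_acc_iff, ConvData.pad_acc_iff, hD (extV hm'm x'), ← hk, hkk', cliqueFn_extV]

/-- Frequent failure propagates DOWN in `δ` (at the cost `c ↦ c + 1`). -/
theorem frequently_not_dataHard_mono {δ' δ : ℝ} (h0 : 0 < δ') (hle : δ' ≤ δ) (h1 : δ < 1) {c : ℕ}
    (h : ∃ᶠ m in atTop, ¬ DataHard δ c m) : ∃ᶠ m in atTop, ¬ DataHard δ' (c + 1) m := by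
  rw [Filter.frequently_atTop] at h ⊢
  intro N
  obtain ⟨M, hM⟩ := (eventually_two_mul_ceil_rpow_le h1).exists_forall_of_atTop
  obtain ⟨m, hm, hbad⟩ := h (max (max M (2 * N)) (2 ^ (c + 1)))
  have hmM : M ≤ m := (le_max_left _ _).trans ((le_max_left _ _).trans hm)
  have hmN : 2 * N ≤ m := (le_max_right _ _).trans ((le_max_left _ _).trans hm)
  have hmc : 2 ^ (c + 1) ≤ m := (le_max_right _ _).trans hm
  obtain ⟨m', hm', hbad'⟩ := not_dataHard_pad h0 hle h1 (hM m hmM) hmc hbad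
  exact ⟨m', by omega, hbad'⟩

/-- **MONOTONICITY IN `δ`.** For `0 < δ' ≤ δ < 1`: `CliqueHard δ' → CliqueHard δ`. -/
theorem cliqueHard_mono {δ' δ : ℝ} (h0 : 0 < δ') (hle : δ' ≤ δ) (h1 : δ < 1)
    (h : CliqueHard δ') : CliqueHard δ := by
  rw [cliqueHard_iff_singleGateHard] at h ⊢
  intro c
  by_contra hc
  have hfreq : ∃ᶠ m in atTop, ¬ DataHard δ c m := by
    simpa only [Filter.not_eventually, gateHard_iff_dataHard] using hc
  have h' := frequently_not_dataHard_mono h0 hle h1 hfreq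
  have hev : ∀ᶠ m in atTop, DataHard δ' (c + 1) m := by
    simpa only [gateHard_iff_dataHard] using h (c + 1)
  obtain ⟨m, hm1, hm2⟩ := (h'.and_eventually hev).exists
  exact hm1 hm2

/-- **The crux forces hardness at every exponent in `[1/2, 1)`** — in particular at the
planted-clique threshold `k = ⌈m^{1/2}⌉₊`. -/
theorem cliqueHard_of_convexGateBlind (h : ConvexGateBlind) {δ : ℝ} (hδ : 1 / 2 ≤ δ) (hδ1 : δ < 1) :
    CliqueHard δ := by
  obtain ⟨δ₀, h0, h12, hH⟩ := convexGateBlind_iff.1 h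
  exact cliqueHard_mono h0 (by linarith) hδ1 hH

/-- **Refutation target.** Beating the bound at ANY single exponent `δ ∈ [1/2, 1)` (polynomial
CONV circuits for `CLIQUE(m, ⌈m^δ⌉₊)` infinitely often, for some fixed `c`) kills the crux. -/
theorem not_convexGateBlind_of_not_cliqueHard {δ : ℝ} (hδ : 1 / 2 ≤ δ) (hδ1 : δ < 1)
    (h : ¬ CliqueHard δ) : ¬ ConvexGateBlind :=
  fun hC => h (cliqueHard_of_convexGateBlind hC hδ hδ1)

/-- **Read-back, interval form**: the crux says that `CliqueHard` holds on a whole interval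
`[δ₀, 1)` with `δ₀ < 1/2`. -/
theorem convexGateBlind_iff_interval :
    ConvexGateBlind ↔ ∃ δ₀ : ℝ, 0 < δ₀ ∧ δ₀ < 1 / 2 ∧ ∀ δ, δ₀ ≤ δ → δ < 1 → CliqueHard δ := by
  rw [convexGateBlind_iff]
  constructor
  · rintro ⟨δ₀, h0, h12, hH⟩
    exact ⟨δ₀, h0, h12, fun δ hle h1 => cliqueHard_mono h0 hle h1 hH⟩
  · rintro ⟨δ₀, h0, h12, hH⟩
    exact ⟨δ₀, h0, h12, hH δ₀ le_rfl (by linarith)⟩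

/-! ### E.5 The boundary `δ = 1` is false: `cliqueHard_mono` cannot reach `δ = 1` -/

/-- `CLIQUE(m, m)` is the AND of all edge variables. -/
theorem cliqueFn_self_eq_true_iff (m : ℕ) (x : E m → Bool) :
    cliqueFn m m x = true ↔ ∀ e, x e = true := by
  classical
  rw [CliqueLPGate.cliqueFn_eq_true_iff_exists]
  constructor
  · rintro ⟨S, hS, hx⟩ e
    have hSu : S = Finset.univ := Finset.eq_univ_of_card S (by rw [hS, Fintype.card_fin])
    exact hx e fun y _ => by rw [hSu]; exact Finset.mem_univ y
  · intro h
    exact ⟨Finset.univ, by rw [Finset.card_univ, Fintype.card_fin], fun e _ => h e⟩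

/-- **`CliqueHard 1` is false** (already at `c = 0`): `⌈m^1⌉₊ = m` and `CLIQUE(m, m) = ∧_{#E}` is
one CONV₁ gate. So the hypothesis `δ < 1` in `cliqueHard_mono` is sharp — otherwise the crux
would refute itself through `cliqueHard_of_convexGateBlind`. -/
theorem not_cliqueHard_one : ¬ CliqueHard 1 := by
  intro h
  obtain ⟨m, hm1, hm⟩ := ((eventually_ge_atTop 1).and (h 0)).exists
  have hk : ⌈(m : ℝ) ^ (1 : ℝ)⌉₊ = m := by rw [Real.rpow_one, Nat.ceil_natCast]
  refine hm (oneGate (GateFn.and (CliqueLPGate.nE m)) fun a => (CliqueLPGate.eE m).symm a)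
    (isOver_oneGate (Or.inr ((and_isConvGate _).mono (by simp))) _) (by simp) fun x => ?_
  rw [eval_oneGate, hk, Bool.eq_iff_iff, cliqueFn_self_eq_true_iff]
  simp only [GateFn.and, decide_eq_true_eq]
  constructor
  · intro hx e
    simpa using hx (CliqueLPGate.eE m e)
  · intro hx a
    exact hx _

/-! ### E.6 Vertex deletion: hardness propagates DOWN in `δ` too — the exponent is immaterial

Zero padding: for `k ≥ 2`, `CLIQUE(m', k)` is the restriction of `CLIQUE(m, k)` (`m' ≤ m`) obtained
by switching OFF every edge at the `m - m'` deleted vertices, and restricting CONV data along it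
keeps the width. Given cheap data for `CLIQUE(M, ⌈M^δ'⌉₊)`, choose `m ≤ M` with
`⌈m^δ⌉₊ = ⌈M^δ'⌉₊` (discrete IVT for `j ↦ ⌈j^δ⌉₊`); then `M ≤ m ^ ⌈(1+δ)/δ'⌉₊`, so width
polynomial in `M` is polynomial in `m`. Hence `CliqueHard δ → CliqueHard δ'` for `0 < δ' ≤ δ ≤ 1`
(`cliqueHard_anti`), and with §E.4 ALL exponents in `(0,1)` give the same statement:
`ConvexGateBlind ↔ CliqueHard δ` for each single `δ ∈ (0,1)` (`convexGateBlind_iff_cliqueHard`).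
-/

open scoped Classical in
/-- Extension of an edge vector of `K_{m'}` to `K_m` by zeros (the new vertices are isolated). -/
def extZ (x' : E m' → Bool) (e : E m) : Bool :=
  decide (∃ e', embE hm e' = e ∧ x' e' = true)

theorem extZ_embE (x' : E m' → Bool) (e' : E m') : extZ hm x' (embE hm e') = x' e' := by
  classical
  unfold extZ
  rw [Bool.eq_iff_iff, decide_eq_true_iff]
  constructor
  · rintro ⟨e'', he, hx⟩
    rwa [← embE_injective hm he]
  · intro hx
    exact ⟨e', rfl, hx⟩

theorem exists_of_extZ_eq_true {x' : E m' → Bool} {e : E m} (h : extZ hm x' e = true) :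
    ∃ e', embE hm e' = e ∧ x' e' = true := by
  classical
  unfold extZ at h
  exact of_decide_eq_true h

theorem extZ_of_not_range (x' : E m' → Bool) (e : E m) (he : ∀ e', embE hm e' ≠ e) :
    extZ hm x' e = false := by
  classical
  unfold extZ
  rw [decide_eq_false_iff_not]
  rintro ⟨e', h, -⟩
  exact he e' h

/-- **Zero padding.** For `k ≥ 2`, `CLIQUE(m, k)` on the zero-extended vector is `CLIQUE(m', k)`:
a `k`-clique with `k ≥ 2` has no isolated vertex, so it lies on the live vertices. -/
theorem cliqueFn_extZ (x' : E m' → Bool) {k : ℕ} (hk : 2 ≤ k) :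
    cliqueFn m k (extZ hm x') = cliqueFn m' k x' := by
  classical
  rw [Bool.eq_iff_iff, CliqueLPGate.cliqueFn_eq_true_iff_exists,
    CliqueLPGate.cliqueFn_eq_true_iff_exists]
  constructor
  · rintro ⟨S, hS, hx⟩
    -- every vertex of `S` is live: it has a neighbour in `S` and the edge to it is switched on
    have hlive : ∀ v ∈ S, (v : ℕ) < m' := by
      intro v hv
      obtain ⟨w, hw, hwv⟩ : ∃ w ∈ S, w ≠ v := by
        by_contra h
        push Not at h
        have hsub : S ⊆ {v} := fun w hw => Finset.mem_singleton.2 (h w hw)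
        have := Finset.card_le_card hsub
        rw [hS, Finset.card_singleton] at this
        omega
      have he : s(v, w) ∈ (⊤ : SimpleGraph (Fin m)).edgeSet :=
        (SimpleGraph.mem_edgeSet ⊤).2 ((SimpleGraph.top_adj v w).2 hwv.symm)
      have hxe := hx ⟨s(v, w), he⟩ (fun y hy => by
        rcases Sym2.mem_iff.1 hy with rfl | rfl
        · exact hv
        · exact hw)
      obtain ⟨e', he', -⟩ := exists_of_extZ_eq_true hm hxe
      exact (lt_of_embE_eq hm he').1
    set T : Finset (Fin m') := Finset.univ.filter fun a => Fin.castLE hm a ∈ S with hT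
    refine ⟨T, ?_, fun e' he' => ?_⟩
    · rw [← hS]
      refine Finset.card_bij (fun a _ => Fin.castLE hm a) (fun a ha => (Finset.mem_filter.1 ha).2)
        (fun a _ b _ h => Fin.castLE_injective hm h) (fun v hv => ?_)
      refine ⟨⟨v, hlive v hv⟩, Finset.mem_filter.2 ⟨Finset.mem_univ _, ?_⟩, Fin.ext rfl⟩
      have : Fin.castLE hm ⟨v, hlive v hv⟩ = v := Fin.ext rfl
      rwa [this]
    · rw [← extZ_embE hm x']
      refine hx _ fun y hy => ?_
      obtain ⟨e'v, he'E⟩ := e'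
      induction e'v using Sym2.ind with
      | h a b =>
        have ha : a ∈ T := he' a (Sym2.mem_mk_left a b)
        have hb : b ∈ T := he' b (Sym2.mem_mk_right a b)
        simp only [hT, Finset.mem_filter, Finset.mem_univ, true_and] at ha hb
        simp only [embE, Sym2.map_mk, Sym2.mem_iff] at hy
        rcases hy with rfl | rfl
        · exact ha
        · exact hb
  · rintro ⟨T, hT, hx⟩
    refine ⟨T.map (Fin.castLEEmb hm), by rw [Finset.card_map, hT], fun e he => ?_⟩
    obtain ⟨e, heE⟩ := e
    induction e using Sym2.ind with
    | h u v =>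
      obtain ⟨a, ha, hau⟩ := Finset.mem_map.1 (he u (Sym2.mem_mk_left u v))
      obtain ⟨b, hb, hbv⟩ := Finset.mem_map.1 (he v (Sym2.mem_mk_right u v))
      have hau' : Fin.castLE hm a = u := hau
      have hbv' : Fin.castLE hm b = v := hbv
      have hne : u ≠ v := (SimpleGraph.top_adj u v).1 ((SimpleGraph.mem_edgeSet ⊤).1 heE)
      have hab : a ≠ b := fun h => hne (by rw [← hau', ← hbv', h])
      have he' : s(a, b) ∈ (⊤ : SimpleGraph (Fin m')).edgeSet :=
        (SimpleGraph.mem_edgeSet ⊤).2 ((SimpleGraph.top_adj a b).2 hab)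
      have hemb : embE hm ⟨s(a, b), he'⟩ = ⟨s(u, v), heE⟩ :=
        Subtype.ext (by simp only [embE, Sym2.map_mk, hau', hbv'])
      rw [← hemb, extZ_embE]
      exact hx _ fun y hy => by
        rcases Sym2.mem_iff.1 hy with rfl | rfl
        · exact ha
        · exact hb

/-- **Restriction of data along zero padding**: dead `B`-columns (edges at deleted vertices,
switched off) are dropped, live columns are re-indexed; the width is unchanged. -/
def ConvData.del {s : ℕ} (D : ConvData (CliqueLPGate.nE m) s) : ConvData (CliqueLPGate.nE m') s where
  p := D.p
  q := D.q
  hpq := D.hpq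
  A := D.A
  b := D.b
  B := fun i a' => D.B i (livePos hm a')
  hB := fun i _ => D.hB i _

theorem ConvData.del_acc_iff {s : ℕ} (D : ConvData (CliqueLPGate.nE m) s) (x' : E m' → Bool) :
    (D.del hm).Acc (fun a' => x' ((CliqueLPGate.eE m').symm a')) ↔
      D.Acc (fun a => extZ hm x' ((CliqueLPGate.eE m).symm a)) := by
  classical
  have hrhs : ∀ i, D.b i + ∑ a, D.B i a *
      (if extZ hm x' ((CliqueLPGate.eE m).symm a) then (1 : ℝ) else 0) =
      (D.del hm).b i + ∑ a', (D.del hm).B i a' *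
        (if x' ((CliqueLPGate.eE m').symm a') then (1 : ℝ) else 0) := by
    intro i
    simp only [ConvData.del, add_right_inj]
    rw [← Finset.sum_filter_add_sum_filter_not Finset.univ (fun a => ∀ a', livePos hm a' ≠ a)]
    have hdead : ∑ a ∈ Finset.univ.filter (fun a => ∀ a', livePos hm a' ≠ a), D.B i a *
        (if extZ hm x' ((CliqueLPGate.eE m).symm a) then (1 : ℝ) else 0) = 0 := by
      refine Finset.sum_eq_zero fun a ha => ?_
      have ha' := (Finset.mem_filter.1 ha).2
      rw [extZ_of_not_range]
      · simp
      · intro e' he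
        apply ha' (CliqueLPGate.eE m' e')
        simp [livePos, he]
    rw [hdead, zero_add]
    have hset : Finset.univ.filter (fun a => ¬ ∀ a', livePos hm a' ≠ a) =
        Finset.univ.image (livePos hm) := by
      ext a
      simp only [Finset.mem_filter, Finset.mem_univ, true_and, Finset.mem_image, not_forall,
        not_not]
    rw [hset, Finset.sum_image fun a _ b _ h => livePos_injective hm h]
    refine Finset.sum_congr rfl fun a' _ => ?_
    simp only [livePos, Equiv.symm_apply_apply, extZ_embE]
  simp only [ConvData.Acc, hrhs]
  exact Iff.rfl

/-- Steps of `j ↦ ⌈j^δ⌉₊` are at most one (`0 ≤ δ ≤ 1`). -/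
theorem ceil_rpow_succ_le (j : ℕ) {δ : ℝ} (h0 : 0 ≤ δ) (h1 : δ ≤ 1) :
    ⌈((j + 1 : ℕ) : ℝ) ^ δ⌉₊ ≤ ⌈(j : ℝ) ^ δ⌉₊ + 1 := by
  have h := rpow_succ_le_rpow_add_one j h0 h1
  calc ⌈((j + 1 : ℕ) : ℝ) ^ δ⌉₊ = ⌈((j : ℝ) + 1) ^ δ⌉₊ := by push_cast; rfl
    _ ≤ ⌈(j : ℝ) ^ δ + 1⌉₊ := Nat.ceil_mono h
    _ = ⌈(j : ℝ) ^ δ⌉₊ + 1 := Nat.ceil_add_one (Real.rpow_nonneg (Nat.cast_nonneg _) _)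

/-- Discrete IVT for `j ↦ ⌈j^δ⌉₊`: every value up to `⌈N^δ⌉₊` is attained at some `j ≤ N`. -/
theorem exists_ceil_rpow_eq {δ : ℝ} (h0 : 0 < δ) (h1 : δ ≤ 1) (N K : ℕ)
    (hK : K ≤ ⌈(N : ℝ) ^ δ⌉₊) : ∃ j ≤ N, ⌈(j : ℝ) ^ δ⌉₊ = K :=
  exists_eq_of_step_le_one (f := fun j => ⌈(j : ℝ) ^ δ⌉₊) (ceil_zero_rpow h0)
    (fun j => ceil_rpow_succ_le j h0.le h1) N K hK

/-- The exponent of the vertex-deletion transfer `(δ', c') ↦ (δ, delExp δ' δ * c')`. -/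
def delExp (δ' δ : ℝ) : ℕ := ⌈(1 + δ) / δ'⌉₊

theorem delExp_pos {δ' δ : ℝ} (h0 : 0 < δ') (hδ : 0 ≤ δ) : 0 < delExp δ' δ :=
  Nat.ceil_pos.2 (div_pos (by linarith) h0)

/-- **Scale comparison.** If `⌈m^δ⌉₊ = ⌈M^δ'⌉₊` with `M ≥ 2` and `0 < δ' ≤ δ`, then
`M ≤ m ^ delExp δ' δ` (`M^δ' < m^δ + 1 ≤ 2 m^δ ≤ m^{1+δ}`, then `δ'`-th roots). -/
theorem le_pow_delExp {δ' δ : ℝ} (h0 : 0 < δ') (hle : δ' ≤ δ) {m M : ℕ} (hM : 2 ≤ M)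
    (hK : ⌈(m : ℝ) ^ δ⌉₊ = ⌈(M : ℝ) ^ δ'⌉₊) : M ≤ m ^ delExp δ' δ := by
  have hδ : 0 < δ := h0.trans_le hle
  have hK2 : 2 ≤ ⌈(M : ℝ) ^ δ'⌉₊ := two_le_ceil_rpow h0 hM
  have hm2 : 2 ≤ m := by
    by_contra hlt
    push Not at hlt
    have h1 : (m : ℝ) ^ δ ≤ 1 :=
      Real.rpow_le_one (Nat.cast_nonneg _) (by exact_mod_cast Nat.lt_succ_iff.1 hlt) hδ.le
    have : ⌈(m : ℝ) ^ δ⌉₊ ≤ 1 := Nat.ceil_le.2 (by simpa using h1)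
    omega
  have hm0 : (0 : ℝ) < m := by exact_mod_cast (show 0 < m by omega)
  have hm1 : (1 : ℝ) ≤ m := by exact_mod_cast (show 1 ≤ m by omega)
  -- `M^δ' < m^(1+δ)`
  have h1 : (M : ℝ) ^ δ' < (m : ℝ) ^ (1 + δ) := by
    have hceil : ((⌈(m : ℝ) ^ δ⌉₊ : ℕ) : ℝ) < (m : ℝ) ^ δ + 1 :=
      Nat.ceil_lt_add_one (Real.rpow_nonneg (Nat.cast_nonneg _) _)
    have hle1 : (M : ℝ) ^ δ' ≤ ((⌈(M : ℝ) ^ δ'⌉₊ : ℕ) : ℝ) := Nat.le_ceil _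
    rw [← hK] at hle1
    have hone : (1 : ℝ) ≤ (m : ℝ) ^ δ := Real.one_le_rpow hm1 hδ.le
    have hsplit : (m : ℝ) ^ (1 + δ) = m * (m : ℝ) ^ δ := by
      rw [Real.rpow_add hm0, Real.rpow_one]
    have h2m : (2 : ℝ) ≤ m := by exact_mod_cast hm2
    calc (M : ℝ) ^ δ' < (m : ℝ) ^ δ + 1 := hle1.trans_lt hceil
      _ ≤ 2 * (m : ℝ) ^ δ := by linarith
      _ ≤ m * (m : ℝ) ^ δ := mul_le_mul_of_nonneg_right h2m (by positivity)
      _ = (m : ℝ) ^ (1 + δ) := hsplit.symm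
  -- take `δ'`-th roots
  have h2 : (M : ℝ) < (m : ℝ) ^ ((1 + δ) / δ') := by
    have hM0 : (0 : ℝ) ≤ M := Nat.cast_nonneg _
    have hroot := Real.rpow_lt_rpow (Real.rpow_nonneg hM0 δ') h1 (one_div_pos.2 h0)
    rw [← Real.rpow_mul hM0, mul_one_div_cancel h0.ne', Real.rpow_one,
      ← Real.rpow_mul hm0.le] at hroot
    rwa [div_eq_mul_one_div]
  have h3 : (m : ℝ) ^ ((1 + δ) / δ') ≤ (m : ℝ) ^ ((delExp δ' δ : ℕ) : ℝ) :=
    Real.rpow_le_rpow_of_exponent_le hm1 (Nat.le_ceil _)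
  rw [Real.rpow_natCast] at h3
  exact_mod_cast (h2.trans_le h3).le

/-- One bad `M` for `(δ', c')` gives a bad `m` for `(δ, delExp δ' δ * c')` with
`M ≤ m ^ delExp δ' δ` (`0 < δ' ≤ δ ≤ 1`, `M ≥ 2`): vertex deletion. -/
theorem not_dataHard_del {δ' δ : ℝ} (h0 : 0 < δ') (hle : δ' ≤ δ) (h1 : δ ≤ 1) {c' M : ℕ}
    (hM : 2 ≤ M) (hbad : ¬ DataHard δ' c' M) :
    ∃ m, M ≤ m ^ delExp δ' δ ∧ ¬ DataHard δ (delExp δ' δ * c') m := by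
  have hδ : 0 < δ := h0.trans_le hle
  set K := ⌈(M : ℝ) ^ δ'⌉₊ with hKdef
  have hK2 : 2 ≤ K := two_le_ceil_rpow h0 hM
  have hM1 : (1 : ℝ) ≤ M := by exact_mod_cast (show 1 ≤ M by omega)
  have hKle : K ≤ ⌈(M : ℝ) ^ δ⌉₊ := Nat.ceil_mono (Real.rpow_le_rpow_of_exponent_le hM1 hle)
  obtain ⟨m, hmM, hm⟩ := exists_ceil_rpow_eq hδ h1 M K hKle
  have hpow : M ≤ m ^ delExp δ' δ := le_pow_delExp h0 hle hM hm
  refine ⟨m, hpow, fun hgood => hbad fun D hD => ?_⟩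
  have hwidth : M ^ c' ≤ m ^ (delExp δ' δ * c') := by
    rw [pow_mul]
    exact Nat.pow_le_pow_left hpow _
  refine hgood ((D.del hmM).widen hwidth) fun x' => ?_
  rw [ConvData.widen_acc_iff, ConvData.del_acc_iff, hD (extZ hmM x'), hm, ← hKdef,
    cliqueFn_extZ hmM x' hK2]

/-- Frequent failure propagates UP in `δ` (polynomial change of scale). -/
theorem frequently_not_dataHard_anti {δ' δ : ℝ} (h0 : 0 < δ') (hle : δ' ≤ δ) (h1 : δ ≤ 1) {c' : ℕ}
    (h : ∃ᶠ M in atTop, ¬ DataHard δ' c' M) :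
    ∃ᶠ m in atTop, ¬ DataHard δ (delExp δ' δ * c') m := by
  rw [Filter.frequently_atTop] at h ⊢
  intro N
  obtain ⟨M, hM, hbad⟩ := h (max 2 (N ^ delExp δ' δ))
  obtain ⟨m, hm, hbad'⟩ := not_dataHard_del h0 hle h1 (le_of_max_le_left hM) hbad
  refine ⟨m, ?_, hbad'⟩
  by_contra hlt
  push Not at hlt
  have hlt' := Nat.pow_lt_pow_left hlt (delExp_pos h0 (h0.le.trans hle)).ne'
  exact absurd ((le_of_max_le_right hM).trans hm) (not_le.2 hlt')

/-- **ANTI-MONOTONICITY IN `δ`.** For `0 < δ' ≤ δ ≤ 1`: `CliqueHard δ → CliqueHard δ'` (vertex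
deletion; the polynomial exponent `c'` becomes `delExp δ' δ * c'`). -/
theorem cliqueHard_anti {δ' δ : ℝ} (h0 : 0 < δ') (hle : δ' ≤ δ) (h1 : δ ≤ 1)
    (h : CliqueHard δ) : CliqueHard δ' := by
  rw [cliqueHard_iff_singleGateHard] at h ⊢
  intro c'
  by_contra hc
  have hfreq : ∃ᶠ M in atTop, ¬ DataHard δ' c' M := by
    simpa only [Filter.not_eventually, gateHard_iff_dataHard] using hc
  have h' := frequently_not_dataHard_anti h0 hle h1 hfreq
  have hev : ∀ᶠ m in atTop, DataHard δ (delExp δ' δ * c') m := by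
    simpa only [gateHard_iff_dataHard] using h (delExp δ' δ * c')
  obtain ⟨m, hm1, hm2⟩ := (h'.and_eventually hev).exists
  exact hm1 hm2

/-- **THE EXPONENT IS IMMATERIAL.** For all `δ, δ' ∈ (0,1)`: `CliqueHard δ ↔ CliqueHard δ'`
(`cliqueHard_mono` upward, `cliqueHard_anti` downward). -/
theorem cliqueHard_iff_cliqueHard {δ δ' : ℝ} (h0 : 0 < δ) (h1 : δ < 1) (h0' : 0 < δ')
    (h1' : δ' < 1) : CliqueHard δ ↔ CliqueHard δ' := by
  rcases le_total δ δ' with h | h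
  · exact ⟨cliqueHard_mono h0 h h1', cliqueHard_anti h0 h h1'.le⟩
  · exact ⟨cliqueHard_anti h0' h h1.le, cliqueHard_mono h0' h h1⟩

/-- **Read-back, fixed-exponent form**: for EACH `δ ∈ (0,1)`, `ConvexGateBlind ↔ CliqueHard δ`.
So the crux is the statement "polynomial `{∧₂, ∨₂} ∪ CONV` circuits do not compute
`CLIQUE(m, ⌈√m⌉₊)`", and equally "… `CLIQUE(m, ⌈m^{1/100}⌉₊)`" or "… `CLIQUE(m, ⌈m^{99/100}⌉₊)`":
provers may fix the most convenient exponent, refuters may attack any single one, and the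
route's window `δ < 1/2` is cosmetic. (Boundaries: `δ = 1` is false, §E.5; constant `k`, the
formal analogue of `δ = 0`, is false, §A3.) -/
theorem convexGateBlind_iff_cliqueHard {δ : ℝ} (h0 : 0 < δ) (h1 : δ < 1) :
    ConvexGateBlind ↔ CliqueHard δ := by
  rw [convexGateBlind_iff]
  constructor
  · rintro ⟨δ₀, h₀, h₀', hH⟩
    exact (cliqueHard_iff_cliqueHard h₀ (by linarith) h0 h1).1 hH
  · intro h
    exact ⟨δ / 2, by linarith, by linarith,
      (cliqueHard_iff_cliqueHard h0 h1 (by linarith) (by linarith)).1 h⟩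

/-- **Refutation target, final form.** Polynomial-width CONV data for `CLIQUE(m, ⌈m^δ⌉₊)`
infinitely often, at ANY one exponent `δ ∈ (0,1)` and one `c`, kill the crux. -/
theorem not_convexGateBlind_of_frequently {δ : ℝ} (h0 : 0 < δ) (h1 : δ < 1) {c : ℕ}
    (h : ∃ᶠ m in atTop, ¬ DataHard δ c m) : ¬ ConvexGateBlind := by
  rw [convexGateBlind_iff_cliqueHard h0 h1, cliqueHard_iff_singleGateHard]
  intro hH
  have hev : ∀ᶠ m in atTop, DataHard δ c m := by
    simpa only [gateHard_iff_dataHard] using hH c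
  obtain ⟨m, hm1, hm2⟩ := (h.and_eventually hev).exists
  exact hm1 hm2

end DeltaMono

/-! ## §D CERTIFICATES: dual certificates are sound, but rejection may be certificate-free

The route's intended method reads a rejecting gate through a DUAL CERTIFICATE (a non-negative
combination of the rows that is psd on the matrix side and negative on the right-hand side).
`ConvData.not_acc_of_certificate`: certificates are sound. `gadget_*`: in the exact-feasibility
format a gate may reject by WEAK INFEASIBILITY with no certificate at all (`Y₀₀ ≤ [u₀]`,
`Y₀₁ ≥ 1`: rejects `u₀ = 0`, yet every `y ≥ 0` psd-nonnegative on the rows has `y·b ≥ 0`). So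
"rejection = certificate" needs a normal form first (e.g. an added trace bound `tr Y ≤ R`, which
changes nothing on the finitely many Boolean inputs and makes the feasible set compact).
-/

section Certificates

/-- Real psd matrices are symmetric. -/
theorem apply_comm_of_posSemidef {n : Type*} {Y : Matrix n n ℝ} (hY : Y.PosSemidef) (i j : n) :
    Y j i = Y i j := by
  simpa [Matrix.conjTranspose_apply] using congrFun (congrFun hY.1 i) j

/-- `tr (A Y) ≥ 0` for real positive semidefinite `A, Y` (Schur product theorem: `A ⊙ Y ⪰ 0`, and
`tr (A Y) = 𝟙ᵀ (A ⊙ Y) 𝟙` for symmetric `Y`). -/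
theorem trace_mul_nonneg_of_posSemidef {n : Type*} [Fintype n] [DecidableEq n] {A Y : Matrix n n ℝ}
    (hA : A.PosSemidef) (hY : Y.PosSemidef) : 0 ≤ (A * Y).trace := by
  have hH := hA.hadamard hY
  have h1 := hH.dotProduct_mulVec_nonneg (fun _ => 1)
  rw [star_trivial] at h1
  have h2 : (fun _ => (1 : ℝ)) ⬝ᵥ (A ⊙ Y) *ᵥ (fun _ => (1 : ℝ)) = (A * Y).trace := by
    simp only [dotProduct, Matrix.mulVec, one_mul, mul_one, Matrix.hadamard_apply, Matrix.trace,
      Matrix.diag, Matrix.mul_apply]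
    exact Finset.sum_congr rfl fun i _ => Finset.sum_congr rfl fun j _ => by
      rw [apply_comm_of_posSemidef hY i j]
  rw [← h2]
  exact h1

/-- **Certificate soundness.** If `y ≥ 0`, `∑ yᵢ Aᵢ ⪰ 0` and `∑ yᵢ (bᵢ + (B u)ᵢ) < 0`, the data
reject `u`. -/
theorem ConvData.not_acc_of_certificate {k s : ℕ} (D : ConvData k s) (u : Fin k → Bool)
    (y : Fin D.p → ℝ) (hy : ∀ i, 0 ≤ y i) (hA : (∑ i, y i • D.A i).PosSemidef)
    (hneg : ∑ i, y i * (D.b i + ∑ j, D.B i j * (if u j then (1 : ℝ) else 0)) < 0) :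
    ¬ D.Acc u := by
  rintro ⟨Y, hY, hrows⟩
  have h0 : 0 ≤ ((∑ i, y i • D.A i) * Y).trace := trace_mul_nonneg_of_posSemidef hA hY
  rw [Matrix.sum_mul, Matrix.trace_sum] at h0
  simp only [Matrix.smul_mul, Matrix.trace_smul, smul_eq_mul] at h0
  have h1 : ∑ i, y i * (D.A i * Y).trace ≤
      ∑ i, y i * (D.b i + ∑ j, D.B i j * (if u j then (1 : ℝ) else 0)) :=
    Finset.sum_le_sum fun i _ => mul_le_mul_of_nonneg_left (hrows i) (hy i)
  linarith

/-- Rows of the weak-infeasibility gadget: `Y₀₀ ≤ [u₀]` and `-Y₀₁ ≤ -1`. -/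
def gadgetA : Fin 2 → Matrix (Fin 2) (Fin 2) ℝ := ![Matrix.single 0 0 1, Matrix.single 1 0 (-1)]

/-- Constants of the gadget. -/
def gadgetb : Fin 2 → ℝ := ![0, -1]

/-- Input coefficients of the gadget (`B ≥ 0`). -/
def gadgetB : Fin 2 → Fin 1 → ℝ := ![fun _ => 1, fun _ => 0]

/-- **The weak-infeasibility gadget** as CONV data (arity 1, width 4). -/
def gadget : ConvData 1 4 :=
  ⟨2, 2, le_rfl, gadgetA, gadgetb, gadgetB, fun i j => by fin_cases i <;> simp [gadgetB]⟩

theorem gadget_acc_iff (u : Fin 1 → Bool) :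
    gadget.Acc u ↔ ∃ Y : Matrix (Fin 2) (Fin 2) ℝ, Y.PosSemidef ∧
      ∀ i : Fin 2, (gadgetA i * Y).trace ≤ gadgetb i + ∑ j, gadgetB i j * (if u j then (1 : ℝ) else 0) :=
  Iff.rfl

/-- The rows of the gadget, unfolded: `Y₀₀ ≤ [u₀]` and `1 ≤ Y₀₁`. -/
theorem gadget_rows_iff (u : Fin 1 → Bool) (Y : Matrix (Fin 2) (Fin 2) ℝ) :
    (∀ i : Fin 2, (gadgetA i * Y).trace ≤ gadgetb i + ∑ j, gadgetB i j * (if u j then (1 : ℝ) else 0)) ↔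
      (Y 0 0 ≤ if u 0 then 1 else 0) ∧ 1 ≤ Y 0 1 := by
  rw [Fin.forall_fin_two]
  simp only [gadgetA, gadgetb, gadgetB, Matrix.cons_val_zero, Matrix.cons_val_one,
    Matrix.trace_single_mul, smul_eq_mul, one_mul, neg_mul, zero_add, Finset.univ_unique,
    Fin.default_eq_zero, Finset.sum_singleton, zero_mul, add_zero]
  constructor
  · rintro ⟨h0, h1⟩; exact ⟨h0, by linarith⟩
  · rintro ⟨h0, h1⟩; exact ⟨h0, by linarith⟩

/-- The gadget accepts `u₀ = 1` (`Y = 𝟙𝟙ᵀ`). -/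
theorem gadget_acc_true : gadget.Acc (fun _ => true) := by
  rw [gadget_acc_iff]
  refine ⟨Matrix.vecMulVec ![1, 1] ![1, 1], ?_, ?_⟩
  · have h := Matrix.posSemidef_vecMulVec_self_star (R := ℝ) (![1, 1] : Fin 2 → ℝ)
    rwa [star_trivial] at h
  · rw [gadget_rows_iff]
    simp [Matrix.vecMulVec_apply]

/-- The gadget rejects `u₀ = 0`: `Y₀₀ ≤ 0` forces the first row of a psd `Y` to vanish,
contradicting `Y₀₁ ≥ 1`. -/
theorem gadget_not_acc_false : ¬ gadget.Acc (fun _ => false) := by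
  rw [gadget_acc_iff]
  rintro ⟨Y, hY, hrows⟩
  rw [gadget_rows_iff] at hrows
  obtain ⟨h0, h1⟩ := hrows
  simp only [Bool.false_eq_true, if_false] at h0
  have hsymm : Y 1 0 = Y 0 1 := apply_comm_of_posSemidef hY 0 1
  have h11 : 0 ≤ Y 1 1 := hY.diag_nonneg
  have hq := hY.dotProduct_mulVec_nonneg ![-(Y 1 1 + 1), 1]
  rw [star_trivial] at hq
  simp [dotProduct, Matrix.mulVec, Fin.sum_univ_two, hsymm] at hq
  nlinarith [sq_nonneg (Y 1 1 + 1), mul_nonneg h11 h11]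

/-- **No certificate exists for that rejection**: every `y ≥ 0` whose row combination is
non-negative on all psd `Y` has `∑ yᵢ (bᵢ + (B u)ᵢ) ≥ 0` at `u₀ = 0` (test `Y = (ε, 1)(ε, 1)ᵀ`,
`ε ↓ 0`). Hence the converse of `ConvData.not_acc_of_certificate` FAILS in the crux's format. -/
theorem gadget_no_certificate (y : Fin 2 → ℝ) (hy : ∀ i, 0 ≤ y i)
    (hA : ∀ Y : Matrix (Fin 2) (Fin 2) ℝ, Y.PosSemidef → 0 ≤ ((∑ i, y i • gadgetA i) * Y).trace) :
    ¬ ∑ i, y i * (gadgetb i + ∑ j, gadgetB i j * (if (fun _ : Fin 1 => false) j then (1 : ℝ) else 0)) < 0 := by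
  intro hneg
  simp [gadgetb, gadgetB, Fin.sum_univ_two] at hneg
  -- `hneg : 0 < y 1`
  have hy0 := hy 0
  set ε : ℝ := y 1 / (2 * (y 0 + 1)) with hε
  have hε0 : 0 < ε := by rw [hε]; positivity
  have hpsd : (Matrix.vecMulVec ![ε, 1] ![ε, 1]).PosSemidef := by
    have h := Matrix.posSemidef_vecMulVec_self_star (R := ℝ) (![ε, 1] : Fin 2 → ℝ)
    rwa [star_trivial] at h
  have h := hA _ hpsd
  rw [Matrix.sum_mul, Matrix.trace_sum, Fin.sum_univ_two] at h
  simp only [gadgetA, Matrix.cons_val_zero, Matrix.cons_val_one, Matrix.smul_mul,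
    Matrix.trace_smul, Matrix.trace_single_mul, smul_eq_mul, Matrix.vecMulVec_apply,
    Matrix.cons_val_zero, Matrix.cons_val_one] at h
  -- `h : 0 ≤ y 0 * (1 * (ε * ε)) + y 1 * (-1 * (ε * 1))`
  have hlt : y 0 * ε < y 1 := by
    have h2 : y 0 * ε ≤ y 1 / 2 := by
      rw [hε, mul_div_assoc', div_le_div_iff₀ (by positivity) (by norm_num)]
      nlinarith
    linarith
  nlinarith [mul_pos hε0 (sub_pos.2 hlt)]

end Certificates

/-! ## §B.2 The theta gate alone never computes CLIQUE: explicit `ϑ`-fooling negatives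

(Placed after §E because it uses `eventually_const_mul_ceil_rpow_le`.) Blow up the 5-cycle:
`blowC5 m t` is the graph on `Fin m` whose live vertices `v < 5t` carry the blob `v % 5 ∈ ℤ/5`, two
live vertices being adjacent iff their blobs are equal or cyclically adjacent; the other vertices
are isolated. Its clique number is `2t` (a clique meets at most two blobs: `C₅` has no triangle),
yet `Y = (25t)⁻¹ · N_{b(u) b(v)}` on live pairs, with `N = 5·I + 3·A(C₅) ≻ 0` (explicit `LDLᵀ`),
is theta-feasible with `⟨J, Y⟩ = 11t/5`. So for `2t < k ≤ 11t/5` the theta gate ACCEPTS a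
`k`-clique-free graph: for every `k ≥ 21` and `m ≥ 3k` the theta gate with threshold `k` does not
compute `CLIQUE(m, k)` (`not_thetaGate_computes`), in particular never `CLIQUE(m, ⌈m^δ⌉₊)` for
large `m` (`eventually_not_thetaGate_computes_cliqueFn`). Consistent with the crux (which predicts
that NO polynomial-width gate is exact); it disposes of the cheapest refutation attempt "ϑ itself
might be exact at some scale `k = m^δ`", complementing the probabilistic `ϑ(G(m,1/2)) ≈ √m`, which
only covers `k ≲ √m`, by a deterministic family at every scale up to `k = m/3`.
-/

section ThetaFooled

open Literature.Combinatorics.SimpleGraph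
open scoped Classical

/-- Eventually `C · ⌈m^δ⌉₊ ≤ m` (`δ < 1`). -/
theorem eventually_const_mul_ceil_rpow_le (C : ℕ) {δ : ℝ} (h1 : δ < 1) :
    ∀ᶠ m : ℕ in atTop, C * ⌈(m : ℝ) ^ δ⌉₊ ≤ m := by
  rcases Nat.eq_zero_or_pos C with rfl | hC
  · exact Filter.Eventually.of_forall fun m => by simp
  have hpos : 0 < 1 - δ := by linarith
  set R : ℝ := (2 * C : ℝ) ^ (1 / (1 - δ)) with hR
  filter_upwards [eventually_ge_atTop (max (2 * C) ⌈R⌉₊)] with m hm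
  have hmC : 2 * C ≤ m := le_of_max_le_left hm
  have hmR : R ≤ m := (Nat.le_ceil R).trans (by exact_mod_cast le_of_max_le_right hm)
  have hm0 : (0 : ℝ) < m := by exact_mod_cast (show 0 < m by omega)
  have hC0 : (0 : ℝ) < C := by exact_mod_cast hC
  have h4 : (2 * C : ℝ) ≤ (m : ℝ) ^ (1 - δ) := by
    calc (2 * C : ℝ) = R ^ (1 - δ) := by
          rw [hR, ← Real.rpow_mul (by positivity), one_div, inv_mul_cancel₀ hpos.ne',
            Real.rpow_one]
      _ ≤ (m : ℝ) ^ (1 - δ) := Real.rpow_le_rpow (by positivity) hmR hpos.le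
  have hδ : (m : ℝ) ^ δ * (2 * C) ≤ m := by
    have hsplit : (m : ℝ) = (m : ℝ) ^ δ * (m : ℝ) ^ (1 - δ) := by
      rw [← Real.rpow_add hm0, add_sub_cancel, Real.rpow_one]
    calc (m : ℝ) ^ δ * (2 * C) ≤ (m : ℝ) ^ δ * (m : ℝ) ^ (1 - δ) :=
          mul_le_mul_of_nonneg_left h4 (by positivity)
      _ = m := hsplit.symm
  have hceil : (⌈(m : ℝ) ^ δ⌉₊ : ℝ) < (m : ℝ) ^ δ + 1 := Nat.ceil_lt_add_one (by positivity)
  have hmC' : (2 * C : ℝ) ≤ m := by exact_mod_cast hmC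
  have hreal : (C : ℝ) * ⌈(m : ℝ) ^ δ⌉₊ ≤ m := by
    nlinarith [mul_le_mul_of_nonneg_left hceil.le hC0.le]
  exact_mod_cast hreal

/-- Cyclic adjacency on `ℤ/5`. -/
def adj5 (i j : Fin 5) : Bool := decide ((i.val + 1) % 5 = j.val ∨ (j.val + 1) % 5 = i.val)

/-- "Equal or adjacent" on `ℤ/5` (adjacency of the blow-up between blobs). -/
def near5 (i j : Fin 5) : Bool := decide (i = j) || adj5 i j

theorem near5_comm (i j : Fin 5) : near5 i j = near5 j i := by
  revert i j
  decide

theorem near5_self (i : Fin 5) : near5 i i = true := by simp [near5]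

/-- `C₅` is triangle-free: no three distinct pairwise equal-or-adjacent residues. -/
theorem no_near5_triangle : ∀ i j l : Fin 5, i ≠ j → i ≠ l → j ≠ l →
    near5 i j = true → near5 i l = true → near5 j l = true → False := by
  decide

/-- A set of pairwise equal-or-adjacent residues has at most two elements. -/
theorem card_le_two_of_near5 (B : Finset (Fin 5)) (hB : ∀ i ∈ B, ∀ j ∈ B, near5 i j = true) :
    B.card ≤ 2 := by
  by_contra h
  push Not at h
  obtain ⟨i, j, l, hi, hj, hl, hij, hil, hjl⟩ := Finset.two_lt_card_iff.1 h
  exact no_near5_triangle i j l hij hil hjl (hB i hi j hj) (hB i hi l hl) (hB j hj l hl)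

/-- The blob of a natural number: its residue mod `5`. -/
def blobN (n : ℕ) : Fin 5 := ⟨n % 5, Nat.mod_lt _ (by norm_num)⟩

theorem blobN_add_mul (j : Fin 5) (q : ℕ) : blobN (j.val + 5 * q) = j := by
  apply Fin.ext
  simp only [blobN, Nat.add_mul_mod_self_left, Nat.mod_eq_of_lt j.2]

/-- **The blown-up 5-cycle** on `Fin m` with blobs of size `t` (vertices `≥ 5t` isolated). -/
def blowC5 (m t : ℕ) : E m → Bool := fun e =>
  Sym2.lift ⟨fun u v => (decide (u.val < t * 5) && decide (v.val < t * 5)) &&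
      near5 (blobN u.val) (blobN v.val),
    fun u v => by
      dsimp only
      rw [near5_comm, Bool.and_comm (decide (u.val < t * 5))]⟩ (e : Sym2 (Fin m))

theorem blowC5_mk {m t : ℕ} {u v : Fin m} (h : s(u, v) ∈ (⊤ : SimpleGraph (Fin m)).edgeSet) :
    blowC5 m t ⟨s(u, v), h⟩ =
      ((decide (u.val < t * 5) && decide (v.val < t * 5)) && near5 (blobN u.val) (blobN v.val)) :=
  rfl

/-- The `5 × 5` matrix `N = 5·I + 3·A(C₅)`. -/
def N5 (i j : Fin 5) : ℝ := if i = j then 5 else if adj5 i j then 3 else 0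

/-- Pivots of the `LDLᵀ` factorisation of `N` (all positive; `det N = 11`). -/
def dv5 : Fin 5 → ℝ := ![5, 16 / 5, 35 / 16, 31 / 35, 11 / 31]

/-- Rows of the unit upper-triangular factor of `N`. -/
def Lv5 : Fin 5 → Fin 5 → ℝ :=
  ![![1, 3 / 5, 0, 0, 3 / 5], ![0, 1, 15 / 16, 0, -9 / 16], ![0, 0, 1, 48 / 35, 27 / 35],
    ![0, 0, 0, 1, 24 / 31], ![0, 0, 0, 0, 1]]

/-- `N = Lᵀ D L`, entrywise (so `N ⪰ 0`). -/
theorem N5_eq_sum (i j : Fin 5) : N5 i j = ∑ r, dv5 r * Lv5 r i * Lv5 r j := by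
  fin_cases i <;> fin_cases j <;> simp [N5, adj5, dv5, Lv5, Fin.sum_univ_five] <;> norm_num

theorem dv5_pos (r : Fin 5) : 0 < dv5 r := by
  fin_cases r <;> norm_num [dv5]

theorem N5_self (i : Fin 5) : N5 i i = 5 := by simp [N5]

theorem N5_nonneg (i j : Fin 5) : 0 ≤ N5 i j := by
  unfold N5; split_ifs <;> norm_num

theorem N5_le_five (i j : Fin 5) : N5 i j ≤ 5 := by
  unfold N5; split_ifs <;> norm_num

theorem N5_eq_zero_of_near5_eq_false {i j : Fin 5} (h : near5 i j = false) : N5 i j = 0 := by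
  unfold N5
  simp only [near5, Bool.or_eq_false_iff, decide_eq_false_iff_not] at h
  rw [if_neg h.1, if_neg (by simp [h.2])]

theorem rowsum_N5 (i : Fin 5) : ∑ j, N5 i j = 11 := by
  fin_cases i <;> simp [N5, adj5, Fin.sum_univ_five] <;> norm_num

/-- Reindexing a sum supported on the live vertices `v < 5t` by (blob row `q`, residue `j`). -/
theorem sum_live {M : Type*} [AddCommMonoid M] {m t : ℕ} (h : t * 5 ≤ m) (g : ℕ → M) :
    ∑ v : Fin m, (if v.val < t * 5 then g v.val else 0) =
      ∑ q : Fin t, ∑ j : Fin 5, g (j.val + 5 * q.val) := by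
  have h1 : ∑ v : Fin m, (if v.val < t * 5 then g v.val else 0) = ∑ a : Fin (t * 5), g a.val := by
    rw [← Finset.sum_filter]
    have hset : (Finset.univ.filter fun v : Fin m => v.val < t * 5) =
        Finset.univ.map (Fin.castLEEmb h) := by
      ext v
      simp only [Finset.mem_filter, Finset.mem_univ, true_and, Finset.mem_map]
      constructor
      · intro hv
        exact ⟨⟨v, hv⟩, Fin.ext rfl⟩
      · rintro ⟨a, rfl⟩
        exact a.2
    rw [hset, Finset.sum_map]
    rfl
  rw [h1, ← Equiv.sum_comp finProdFinEquiv, Fintype.sum_prod_type]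
  rfl

variable (m t : ℕ)

/-- The theta witness for the blow-up: `Y_{uv} = N_{b(u) b(v)} / (25 t)` on live pairs. -/
def Yblow : Matrix (Fin m) (Fin m) ℝ := fun u v =>
  if u.val < t * 5 then (if v.val < t * 5 then N5 (blobN u.val) (blobN v.val) / (25 * t) else 0)
  else 0

/-- The vectors of the `LDLᵀ` factorisation, spread over the blobs. -/
def avec (r : Fin 5) : Fin m → ℝ := fun v => if v.val < t * 5 then Lv5 r (blobN v.val) else 0

theorem Yblow_eq_sum :
    Yblow m t = ∑ r, (dv5 r / (25 * t)) • Matrix.vecMulVec (avec m t r) (avec m t r) := by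
  ext u v
  simp only [Yblow, Matrix.sum_apply, Matrix.smul_apply, Matrix.vecMulVec_apply, avec,
    smul_eq_mul]
  by_cases hu : u.val < t * 5
  · by_cases hv : v.val < t * 5
    · simp only [hu, hv, if_true, N5_eq_sum, Finset.sum_div]
      exact Finset.sum_congr rfl fun r _ => by ring
    · simp [hu, hv]
  · simp [hu]

/-- `Y ⪰ 0`. -/
theorem Yblow_posSemidef : (Yblow m t).PosSemidef := by
  rw [Yblow_eq_sum]
  refine posSemidef_sum _ _ fun r _ => ?_
  have h := Matrix.posSemidef_vecMulVec_self_star (R := ℝ) (avec m t r)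
  rw [star_trivial] at h
  exact h.smul (div_nonneg (dv5_pos r).le (by positivity))

variable {m t}

/-- `tr Y = 1`. -/
theorem trace_Yblow (ht : 1 ≤ t) (h : t * 5 ≤ m) : (Yblow m t).trace = 1 := by
  have ht0 : (t : ℝ) ≠ 0 := by exact_mod_cast (show t ≠ 0 by omega)
  calc (Yblow m t).trace
      = ∑ v : Fin m, (if v.val < t * 5 then
          (fun n : ℕ => N5 (blobN n) (blobN n) / (25 * (t : ℝ))) v.val else 0) :=
        Finset.sum_congr rfl fun v _ => by simp only [Matrix.diag, Yblow]; split_ifs <;> rfl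
    _ = ∑ q : Fin t, ∑ j : Fin 5, (fun n : ℕ => N5 (blobN n) (blobN n) / (25 * (t : ℝ)))
          (j.val + 5 * q.val) := sum_live h (fun n : ℕ => N5 (blobN n) (blobN n) / (25 * (t : ℝ)))
    _ = 1 := by
        simp only [blobN_add_mul, N5_self, Finset.sum_const, Finset.card_univ, Fintype.card_fin,
          nsmul_eq_mul]
        field_simp
        push_cast
        ring

/-- `⟨J, Y⟩ = 11t/5`. -/
theorem entrySum_Yblow (ht : 1 ≤ t) (h : t * 5 ≤ m) : entrySum (Yblow m t) = 11 * t / 5 := by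
  have ht0 : (t : ℝ) ≠ 0 := by exact_mod_cast (show t ≠ 0 by omega)
  have hinner : ∀ u : Fin m, ∑ v, Yblow m t u v = if u.val < t * 5 then (11 : ℝ) / 25 else 0 := by
    intro u
    by_cases hu : u.val < t * 5
    · rw [if_pos hu]
      calc ∑ v, Yblow m t u v
          = ∑ v : Fin m, (if v.val < t * 5 then
              (fun n : ℕ => N5 (blobN u.val) (blobN n) / (25 * (t : ℝ))) v.val else 0) :=
            Finset.sum_congr rfl fun v _ => by simp only [Yblow, if_pos hu]
        _ = ∑ q : Fin t, ∑ j : Fin 5, (fun n : ℕ => N5 (blobN u.val) (blobN n) / (25 * (t : ℝ)))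
              (j.val + 5 * q.val) :=
            sum_live h (fun n : ℕ => N5 (blobN u.val) (blobN n) / (25 * (t : ℝ)))
        _ = 11 / 25 := by
            simp only [blobN_add_mul, ← Finset.sum_div, rowsum_N5, Finset.sum_const,
              Finset.card_univ, Fintype.card_fin, nsmul_eq_mul]
            field_simp
    · rw [if_neg hu]
      exact Finset.sum_eq_zero fun v _ => by simp only [Yblow, if_neg hu]
  calc entrySum (Yblow m t) = ∑ u : Fin m, ∑ v, Yblow m t u v := rfl
    _ = ∑ u : Fin m, (if u.val < t * 5 then (fun _ : ℕ => (11 : ℝ) / 25) u.val else 0) :=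
        Finset.sum_congr rfl fun u _ => hinner u
    _ = ∑ q : Fin t, ∑ j : Fin 5, (fun _ : ℕ => (11 : ℝ) / 25) (j.val + 5 * q.val) :=
        sum_live h (fun _ : ℕ => (11 : ℝ) / 25)
    _ = 11 * t / 5 := by
        simp only [Finset.sum_const, Finset.card_univ, Fintype.card_fin, nsmul_eq_mul]
        push_cast
        ring

/-- Off-diagonal entries: `|Y_{uv}| ≤ [uv ∈ blowC5]`. -/
theorem abs_Yblow_le (ht : 1 ≤ t) (p : OP m) :
    |Yblow m t p.1.1 p.1.2| ≤ if blowC5 m t (edgeOf p) then 1 else 0 := by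
  obtain ⟨⟨u, v⟩, huv⟩ := p
  show |Yblow m t u v| ≤ if blowC5 m t ⟨s(u, v), _⟩ then 1 else 0
  rw [blowC5_mk]
  have ht1 : (1 : ℝ) ≤ t := by exact_mod_cast ht
  have hrhs : (0 : ℝ) ≤ if ((decide (u.val < t * 5) && decide (v.val < t * 5)) &&
      near5 (blobN u.val) (blobN v.val)) = true then 1 else 0 := by
    split_ifs <;> norm_num
  by_cases hu : u.val < t * 5
  · by_cases hv : v.val < t * 5
    · by_cases hn : near5 (blobN u.val) (blobN v.val) = true
      · have hif : (if ((decide (u.val < t * 5) && decide (v.val < t * 5)) &&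
            near5 (blobN u.val) (blobN v.val)) = true then (1 : ℝ) else 0) = 1 := by
          simp [hu, hv, hn]
        rw [hif]
        simp only [Yblow, if_pos hu, if_pos hv]
        rw [abs_of_nonneg (div_nonneg (N5_nonneg _ _) (by positivity)),
          div_le_one (by positivity)]
        linarith [N5_le_five (blobN u.val) (blobN v.val)]
      · rw [Bool.not_eq_true] at hn
        simp only [Yblow, if_pos hu, if_pos hv, N5_eq_zero_of_near5_eq_false hn, zero_div,
          abs_zero]
        exact hrhs
    · simp only [Yblow, if_pos hu, if_neg hv, abs_zero]
      exact hrhs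
  · simp only [Yblow, if_neg hu, abs_zero]
    exact hrhs

/-- **The theta gate accepts the blow-up** whenever `5k ≤ 11t` (`t ≥ 1`, `5t ≤ m`). -/
theorem thetaAcc_blowC5 (ht : 1 ≤ t) (h : t * 5 ≤ m) {k : ℕ} (hk : 5 * k ≤ 11 * t) :
    ThetaAcc m k (fun j => blowC5 m t ((CliqueLPGate.eE m).symm j)) := by
  rw [thetaAcc_iff]
  refine ⟨Yblow m t, Yblow_posSemidef m t, trace_Yblow ht h, ?_, abs_Yblow_le ht⟩
  rw [entrySum_Yblow ht h]
  have : (5 : ℝ) * k ≤ 11 * t := by exact_mod_cast hk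
  linarith

/-- Number of live vertices in one blob: `t`. -/
theorem card_live_blob (h : t * 5 ≤ m) (i : Fin 5) :
    (Finset.univ.filter fun v : Fin m => v.val < t * 5 ∧ blobN v.val = i).card = t := by
  calc (Finset.univ.filter fun v : Fin m => v.val < t * 5 ∧ blobN v.val = i).card
      = ∑ v : Fin m, (if v.val < t * 5 ∧ blobN v.val = i then 1 else 0) := Finset.card_filter _ _
    _ = ∑ v : Fin m, (if v.val < t * 5 then
          (fun n : ℕ => if blobN n = i then (1 : ℕ) else 0) v.val else 0) :=
        Finset.sum_congr rfl fun v _ => by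
          by_cases h1 : v.val < t * 5 <;> by_cases h2 : blobN v.val = i <;> simp [h1, h2]
    _ = ∑ q : Fin t, ∑ j : Fin 5, (fun n : ℕ => if blobN n = i then (1 : ℕ) else 0)
          (j.val + 5 * q.val) := sum_live h (fun n : ℕ => if blobN n = i then (1 : ℕ) else 0)
    _ = t := by simp [blobN_add_mul, Finset.sum_ite_eq']

/-- **The blow-up is `(2t+1)`-clique-free** (a clique meets at most two blobs). -/
theorem cliqueFn_blowC5 (ht : 1 ≤ t) (h : t * 5 ≤ m) {k : ℕ} (hk : 2 * t + 1 ≤ k) :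
    cliqueFn m k (blowC5 m t) = false := by
  rw [← Bool.not_eq_true, CliqueLPGate.cliqueFn_eq_true_iff_exists]
  rintro ⟨S, hS, hx⟩
  -- adjacency inside `S`
  have hadj : ∀ u ∈ S, ∀ v ∈ S, u ≠ v →
      u.val < t * 5 ∧ v.val < t * 5 ∧ near5 (blobN u.val) (blobN v.val) = true := by
    intro u hu v hv huv
    have he : s(u, v) ∈ (⊤ : SimpleGraph (Fin m)).edgeSet :=
      (SimpleGraph.mem_edgeSet ⊤).2 ((SimpleGraph.top_adj u v).2 huv)
    have hxe := hx ⟨s(u, v), he⟩ (fun y hy => by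
      rcases Sym2.mem_iff.1 hy with rfl | rfl
      · exact hu
      · exact hv)
    rw [blowC5_mk] at hxe
    simp only [Bool.and_eq_true, decide_eq_true_eq] at hxe
    exact ⟨hxe.1.1, hxe.1.2, hxe.2⟩
  -- every vertex of `S` is live (`k ≥ 2`)
  have hlive : ∀ u ∈ S, u.val < t * 5 := by
    intro u hu
    obtain ⟨v, hv, hvu⟩ : ∃ v ∈ S, v ≠ u := by
      by_contra hc
      push Not at hc
      have hsub : S ⊆ {u} := fun w hw => Finset.mem_singleton.2 (hc w hw)
      have := Finset.card_le_card hsub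
      rw [hS, Finset.card_singleton] at this
      omega
    exact (hadj u hu v hv hvu.symm).1
  -- the blobs met by `S` are pairwise equal-or-adjacent, hence at most two
  set B : Finset (Fin 5) := S.image fun v => blobN v.val with hB
  have hBnear : ∀ i ∈ B, ∀ j ∈ B, near5 i j = true := by
    intro i hi j hj
    obtain ⟨u, hu, rfl⟩ := Finset.mem_image.1 hi
    obtain ⟨v, hv, rfl⟩ := Finset.mem_image.1 hj
    by_cases huv : u = v
    · subst huv
      exact near5_self _
    · exact (hadj u hu v hv huv).2.2
  have hBcard : B.card ≤ 2 := card_le_two_of_near5 B hBnear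
  -- `S` lies in the live parts of the blobs of `B`
  have hsub : S ⊆ B.biUnion fun i =>
      Finset.univ.filter fun v : Fin m => v.val < t * 5 ∧ blobN v.val = i := by
    intro u hu
    simp only [Finset.mem_biUnion, Finset.mem_filter, Finset.mem_univ, true_and]
    exact ⟨blobN u.val, Finset.mem_image_of_mem _ hu, hlive u hu, rfl⟩
  have hcard : S.card ≤ B.card * t := by
    refine (Finset.card_le_card hsub).trans (Finset.card_biUnion_le.trans ?_)
    rw [Finset.sum_congr rfl fun i _ => card_live_blob h i, Finset.sum_const, smul_eq_mul]
  rw [hS] at hcard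
  have := Nat.mul_le_mul_right t hBcard
  omega

/-- **The theta gate is fooled**: for `k ≥ 21` and `m ≥ 3k` some `k`-clique-free graph on `m`
vertices is ACCEPTED by `thetaGate m k` (the blow-up with `t = ⌈5k/11⌉₊`: `2t < k ≤ 11t/5`). -/
theorem thetaGate_fooled {k m : ℕ} (hk : 21 ≤ k) (hm : 3 * k ≤ m) :
    ∃ x : E m → Bool, cliqueFn m k x = false ∧
      (thetaGate m k).2 (fun j => x ((CliqueLPGate.eE m).symm j)) = true := by
  set t : ℕ := (5 * k + 10) / 11 with ht
  have ht1 : 1 ≤ t := by omega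
  have htm : t * 5 ≤ m := by omega
  have hk1 : 2 * t + 1 ≤ k := by omega
  have hk2 : 5 * k ≤ 11 * t := by omega
  refine ⟨blowC5 m t, cliqueFn_blowC5 ht1 htm hk1, ?_⟩
  show decide (ThetaAcc m k fun j => blowC5 m t ((CliqueLPGate.eE m).symm j)) = true
  exact decide_eq_true (thetaAcc_blowC5 ht1 htm hk2)

/-- **The theta gate does not compute `CLIQUE(m, k)`** for `k ≥ 21`, `m ≥ 3k`. -/
theorem not_thetaGate_computes {k m : ℕ} (hk : 21 ≤ k) (hm : 3 * k ≤ m) :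
    ¬ ∀ x : E m → Bool, (thetaGate m k).2 (fun j => x ((CliqueLPGate.eE m).symm j)) =
      cliqueFn m k x := by
  intro h
  obtain ⟨x, hx, hacc⟩ := thetaGate_fooled hk hm
  rw [h x, hx] at hacc
  exact Bool.false_ne_true hacc

/-- **In the crux's regime the theta gate is never exact**: for `0 < δ < 1`, eventually in `m`,
`thetaGate m ⌈m^δ⌉₊` does not compute `CLIQUE(m, ⌈m^δ⌉₊)`. -/
theorem eventually_not_thetaGate_computes_cliqueFn {δ : ℝ} (hδ : 0 < δ) (hδ1 : δ < 1) :
    ∀ᶠ m : ℕ in atTop, ¬ ∀ x : E m → Bool,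
      (thetaGate m ⌈(m : ℝ) ^ δ⌉₊).2 (fun j => x ((CliqueLPGate.eE m).symm j)) =
        cliqueFn m ⌈(m : ℝ) ^ δ⌉₊ x := by
  have h21 : ∀ᶠ m : ℕ in atTop, 21 ≤ ⌈(m : ℝ) ^ δ⌉₊ := by
    filter_upwards [eventually_ge_atTop ⌈((21 : ℝ) ^ (1 / δ))⌉₊] with m hm
    have hm' : (21 : ℝ) ^ (1 / δ) ≤ m := (Nat.le_ceil _).trans (by exact_mod_cast hm)
    have h1 : (21 : ℝ) ≤ (m : ℝ) ^ δ := by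
      calc (21 : ℝ) = ((21 : ℝ) ^ (1 / δ)) ^ δ := by
            rw [← Real.rpow_mul (by norm_num), one_div, inv_mul_cancel₀ hδ.ne', Real.rpow_one]
        _ ≤ (m : ℝ) ^ δ := Real.rpow_le_rpow (by positivity) hm' hδ.le
    exact_mod_cast h1.trans (Nat.le_ceil _)
  filter_upwards [h21, eventually_const_mul_ceil_rpow_le 3 hδ1] with m hm1 hm2
  exact not_thetaGate_computes hm1 hm2

end ThetaFooled

end

end Summit.PneNP.PneNP.Cruxes.ConvexGateBlind.Disproof
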